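import Literature.NumberTheory.Sieve.HeathBrownCubicTypeIMoebius
import Literature.NumberTheory.Sieve.HeathBrownCubicUpperBoundTools
import HarnessLib

/-!
# Heath-Brown's Type I bound for `𝒜^(K)` (Lemma 3.2) from Lemmas 4.7 and 5.1 (pp. 30–32)

Pure-proof file (no definitions, no named facts) in the decomposition of **parity.S18** along
D. R. Heath-Brown, *Primes represented by `x³ + 2y³`*, Acta Math. 186 (2001), 1–84. The named fact
`HeathBrown2001_typeI_A` of `HeathBrownCubicSieveSetup` is **Lemma 3.2**, the Type I bound
`∑_{Q<N(R)≤2Q, R∈𝒯r} τ(R)^A |#𝒜^(K)_R − (6η²X²/π²)ρ₂(R)/N(R)| ≪ (Q + XQ^{1/2} + X^{3/2})(log QX)^{c(A)}`.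
The paper proves it in §5 (pp. 30–32) from two deeper inputs — **Lemma 5.1** (the same bound for
`S(R; X) = #{x, y ∈ (X, X(1+η)] : R ∣ x + y·2^{1/3}}`, without the coprimality condition, with main
term `η²X²/N(R)` and bound `(X + Q)(log Q)^{c(A)}`) and **Lemma 4.7** (`∑ τ(m + n·2^{1/3})^A ≪ xy(log xy)^{c}`
over boxes) — together with the elementary Lemmas 4.2, 4.3 and the identities (5.3), (5.4). This file
carries out that deduction completely: its final theorem `HeathBrown2001_typeI_A_of_bounds` proves
`HeathBrown2001_typeI_A` from the statements of Lemma 4.7 and Lemma 5.1 taken as hypotheses (they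
are rendered exactly as in the module docstring of `HeathBrownCubicTypeITools`: explicit constants
`c, C ≥ 0` depending on `A`; Lemma 5.1 uniformly in `0 < η ≤ 1`, `Q > 0`, since it is applied at
`(X/d, Q/N(S))`). The inputs proved earlier in the tree are (5.3) and (5.4)
(`HeathBrownCubicTypeIMoebius`: `countA_eq_sum_moebius`, `mainTerm_eq_tsum`,
`absNorm_sup_span_natCast`), Lemma 4.3 and `S(R; X)` (`HeathBrownCubicTypeITools`), Lemma 4.2 over `K`
(`HeathBrownCubicSieveSetupProofs`) and over `ℤ` (`DivisorPowerSums`).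

## Content (namespace `Literature.NumberTheory.Sieve.CubicSieve`), in the order of the argument

* Tail of the singular series: `sum_Ioc_gcd_div_sq_le` (`∑_{Δ<d≤N} (m,d)/d² ≤ 4τ(m)/Δ`, via
  `(m,d) ≤ ∑_{e∣m, e∣d} e` and the tails of `∑ 1/k²`), `abs_tsum_moebius_gcd_div_sq_tail_le`,
  `tsum_moebius_gcd_div_sq_eq_sum_add_tail` — our replacement for (5.5), pointwise in `R`.
* Divisor bookkeeping: `exists_sum_idealDivisorCount_pow_mul_sigma_pow_le` (Lemma 4.2 over `K` with
  an extra factor `τ(N(R))^B`), `sum_filter_dvd_pow_le` (`∑_{R∣J} τ(R)^A ≤ τ(J)^{A+1}`),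
  `idealDivisorCount_span_natCast_le` (`τ((d)) ≤ τ(d)^{12}`), `sum_latticeBox_le_sum_Icc` (the box of
  `S(·; X/d)` inside Lemma 4.7's range), `sum_pow_mul_card_filter_dvd_le` (the regrouping for (5.6)).
* `sum_trBlock_head_le` — the regrouping `S = (R,d)`, `R = ST` of p. 32 for the head `d ≤ Δ`
  (injectivity of `R ↦ R/(R,d)` on the fibres, `R ∣ (d)I ⟺ T ∣ I`, `N(R) = N(S)N(T)`,
  `τ(R) ≤ τ(S)τ(T)`), producing exactly the sums of Lemma 5.1 at `(X/d, Q/N(S))`.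
* `abs_countA_sub_mainTerm_le` — the split at `Δ` (p. 31) for one `R ∈ 𝒯r`:
  `|#𝒜^(K)_R − MT(R)| ≤ ∑_{d≤Δ} |S_d(R) − η²X²N((R,d))/(d²N(R))| + ∑_{Δ<d≤D} S_d(R) + (η²X²/N(R))·4τ(N(R))/Δ`.
* `head_term_le`, `tail56_term_le`, `exists_tail55_le`, `head_total_le`, `tail56_total_le` — the three
  pieces summed over `R` and then over `d`, against the hypotheses of Lemmas 5.1 / 4.7 and the moments
  of `τ`; `rpow_le_inv_log_two_pow_mul`, `log_bounds`, `delta_bounds` — the bookkeeping of logarithms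
  and of `Δ = 1 + min(X^{1/2}, XQ^{-1/2})` ("essentially optimal", p. 32).
* **`HeathBrown2001_typeI_A_of_bounds`** — Lemma 3.2 from Lemma 4.7 and Lemma 5.1.

## Faithfulness / deviations from the printed proof

* (5.5) (the tail `d > Δ` of (5.4)) is bounded pointwise in `R` by `4τ(N(R))/Δ` and then summed with
  Lemma 4.2, instead of the paper's averaged form; (5.6) is regrouped directly
  (`∑_{R∣(d)I} τ(R)^A ≤ τ((d))^{A+1}τ(I)^{A+1}`) instead of through `R = ST`; both give the printed
  orders `η²X²Δ^{-1}(log)^c`, `X²Δ^{-1}(log X)^c`. All exponents of `log` are explicit but not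
  optimised (`c(A)` is a sum of the input exponents and `2^{12(A+1)+1}`, `2^{4A+5}`).
* Nothing here is conditional on unproved facts except through the two hypotheses of the final
  theorem, which are the statements of Lemmas 4.7 and 5.1 themselves.

## References

* D. R. Heath-Brown, *Primes represented by `x³ + 2y³`*, Acta Math. 186 (2001), 1–84: Lemma 3.2
  (p. 11), §5 pp. 28–32 (Lemma 5.1, (5.3)–(5.6), the choice of `Δ`), Lemmas 4.2, 4.3, 4.7
  (pp. 22–25). [cite: HeathBrownActa2001, §5 pp. 30–32]

## Mathlib / tree search

Mathlib: `sum_Ioc_inv_sq_le_sub`, `Real.tsum_le_of_sum_range_le`, `norm_tsum_le_tsum_norm`,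
`Summable.sum_add_tsum_nat_add`, `summable_nat_add_iff`, `Finset.sum_fiberwise_of_maps_to`,
`Finset.sum_image`, `Finset.sum_comm`, `Finset.sum_Ico_consecutive`, `Real.rpow_le_rpow_of_nonpos`,
`Real.rpow_natCast`, `Nat.floor_lt`, `Real.sqrt_le_left`. Tree: `HeathBrownCubicTypeIMoebius`,
`HeathBrownCubicUpperBoundTools` (`sum_inv_sq_tail_le`),
`HeathBrownCubicTypeITools` (`latticeBox`, `latticeCount`, `idealDivisorCount_mul_le`,
`mem_filter_dvd_idealsLE_iff`), `HeathBrownCubicSieveSetupProofs` (`idealDivisorCount_le_sigma_zero_pow_four`,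
`idealNormCount_le_sigma_zero_pow_three`, `card_filter_absNorm_eq`), `DivisorPowerSums`
(`exists_sum_sigma_zero_pow_le`, `exists_sum_sigma_zero_pow_le_real`,
`exists_sum_sigma_zero_pow_div_le_real`, `sigma_zero_mul_le`), `HeathBrownCubicSieveSetup`
(`countA`, `rho₂`, `pairIdeal_ne_bot`, `pairElt_eq_intCast`, the fact `HeathBrown2001_typeI_A`).
-/

noncomputable section

open NumberField Finset Filter
open scoped Topology ArithmeticFunction.sigma

namespace Literature.NumberTheory.Sieve.CubicSieve

open LFunctions.CubeRootTwoField

/-! ### The tail of the singular series: `∑_{d > Δ} (m, d)/d² ≤ 4τ(m)/Δ` (cf. (5.5)) -/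

/-- `∑_{k ∈ U} 1/k² ≤ 2` for any finite set of natural numbers (`1/0² = 0` by convention;
`∑_{k ≥ 2} 1/k² ≤ 1` by telescoping, Mathlib's `sum_Ioc_inv_sq_le_sub`). [folklore] -/
theorem sum_inv_sq_le_two (U : Finset ℕ) : ∑ k ∈ U, ((k : ℝ) ^ 2)⁻¹ ≤ 2 := by
  set M : ℕ := U.sup id + 1 with hM
  have hsub : U ⊆ insert 0 (insert 1 (Ioc 1 M)) := by
    intro k hk
    simp only [mem_insert, mem_Ioc]
    have hkM : k ≤ M := (le_sup (f := id) hk).trans (Nat.le_succ _)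
    omega
  calc ∑ k ∈ U, ((k : ℝ) ^ 2)⁻¹ ≤ ∑ k ∈ insert 0 (insert 1 (Ioc 1 M)), ((k : ℝ) ^ 2)⁻¹ :=
        sum_le_sum_of_subset_of_nonneg hsub fun k _ _ => by positivity
    _ = 1 + ∑ k ∈ Ioc 1 M, ((k : ℝ) ^ 2)⁻¹ := by
        rw [sum_insert (by simp), sum_insert (by simp)]
        simp
    _ ≤ 1 + ((1 : ℕ) : ℝ)⁻¹ := by
        have h := sum_Ioc_inv_sq_le_sub (α := ℝ) one_ne_zero (by omega : 1 ≤ M)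
        have hM0 : (0 : ℝ) ≤ (M : ℝ)⁻¹ := by positivity
        linarith
    _ = 2 := by norm_num

/-- The multiples of `e ≥ 1` beyond `Δ ≥ 1` have `∑ 1/d² ≤ 4/(eΔ)` (`d = ek` with `k > Δ/e`: if
`Δ/e ≥ 2` the tail of `∑ 1/k²` is `≤ 2e/Δ` (`sum_inv_sq_tail_le` of `HeathBrownCubicUpperBoundTools`),
otherwise the whole sum is `≤ 2 ≤ 4e/Δ`). [folklore] -/
theorem sum_filter_dvd_inv_sq_le {e Δ : ℕ} (he : 0 < e) (hΔ : 0 < Δ) (N : ℕ) :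
    ∑ d ∈ (Ioc Δ N).filter (e ∣ ·), ((d : ℝ) ^ 2)⁻¹ ≤ 4 / (e * Δ) := by
  set T := (Ioc Δ N).filter (e ∣ ·) with hT
  have he' : (0 : ℝ) < e := by exact_mod_cast he
  have hΔ' : (0 : ℝ) < Δ := by exact_mod_cast hΔ
  -- reindex by `k = d / e`
  have hinj : Set.InjOn (fun d : ℕ => d / e) ↑T := by
    intro a ha b hb hab
    rw [mem_coe, hT, mem_filter] at ha hb
    rw [← Nat.div_mul_cancel ha.2, ← Nat.div_mul_cancel hb.2]
    simp only at hab
    rw [hab]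
  have hterm : ∀ d ∈ T, ((d : ℝ) ^ 2)⁻¹ = ((e : ℝ) ^ 2)⁻¹ * ((((d / e : ℕ) : ℕ) : ℝ) ^ 2)⁻¹ := by
    intro d hd
    rw [hT, mem_filter] at hd
    rw [← mul_inv, ← mul_pow]
    congr 2
    exact_mod_cast (Nat.mul_div_cancel' hd.2).symm
  rw [sum_congr rfl hterm, ← mul_sum, ← sum_image (g := fun d : ℕ => d / e)
    (f := fun k : ℕ => ((k : ℝ) ^ 2)⁻¹) hinj]
  have hUlt : ∀ k ∈ T.image (fun d : ℕ => d / e), (Δ : ℝ) / e < (k : ℝ) := by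
    intro k hk
    rw [mem_image] at hk
    obtain ⟨d, hd, rfl⟩ := hk
    rw [hT, mem_filter, mem_Ioc] at hd
    rw [div_lt_iff₀ he']
    have h : ((d / e : ℕ) : ℝ) * e = d := by exact_mod_cast Nat.div_mul_cancel hd.2
    rw [h]
    exact_mod_cast hd.1.1
  rcases le_or_gt (2 : ℝ) ((Δ : ℝ) / e) with h2 | h2
  · calc ((e : ℝ) ^ 2)⁻¹ * ∑ k ∈ T.image (fun d : ℕ => d / e), ((k : ℝ) ^ 2)⁻¹
        ≤ ((e : ℝ) ^ 2)⁻¹ * (2 / ((Δ : ℝ) / e)) :=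
          mul_le_mul_of_nonneg_left (sum_inv_sq_tail_le h2 _ hUlt) (by positivity)
      _ = 2 / (e * Δ) := by field_simp
      _ ≤ 4 / (e * Δ) := by gcongr; norm_num
  · have hΔe : (Δ : ℝ) < 2 * e := by rwa [div_lt_iff₀ he'] at h2
    calc ((e : ℝ) ^ 2)⁻¹ * ∑ k ∈ T.image (fun d : ℕ => d / e), ((k : ℝ) ^ 2)⁻¹
        ≤ ((e : ℝ) ^ 2)⁻¹ * 2 := mul_le_mul_of_nonneg_left (sum_inv_sq_le_two _) (by positivity)
      _ = 2 / ((e : ℝ) * e) := by rw [sq]; ring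
      _ ≤ 4 / (e * Δ) := by
          rw [div_le_div_iff₀ (by positivity) (by positivity)]
          nlinarith

/-- `(m, d) ≤ ∑_{e ∣ m, e ∣ d} e` for `m ≥ 1` (the gcd is one of the terms). [folklore] -/
theorem gcd_le_sum_divisors_filter_dvd {m : ℕ} (hm : 0 < m) (d : ℕ) :
    (Nat.gcd m d : ℝ) ≤ ∑ e ∈ m.divisors.filter (· ∣ d), (e : ℝ) := by
  have hmem : Nat.gcd m d ∈ m.divisors.filter (· ∣ d) :=
    mem_filter.mpr ⟨Nat.mem_divisors.mpr ⟨Nat.gcd_dvd_left _ _, hm.ne'⟩, Nat.gcd_dvd_right _ _⟩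
  exact single_le_sum (f := fun e : ℕ => (e : ℝ)) (fun e _ => Nat.cast_nonneg e) hmem

/-- **The tail of the singular series over a finite range**: for `m, Δ ≥ 1` and every `N`,
`∑_{Δ < d ≤ N} (m, d)/d² ≤ 4τ(m)/Δ` (write `(m,d) ≤ ∑_{e ∣ m, e ∣ d} e` and sum the multiples of
each `e ∣ m` with `sum_filter_dvd_inv_sq_le`). This replaces the estimate (5.5) of the paper, which
bounds the same tails on average over `R`; pointwise in `R` it costs nothing here. [cite: HeathBrownActa2001, §5 (5.5)] -/
theorem sum_Ioc_gcd_div_sq_le {m Δ : ℕ} (hm : 0 < m) (hΔ : 0 < Δ) (N : ℕ) :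
    ∑ d ∈ Ioc Δ N, (Nat.gcd m d : ℝ) / (d : ℝ) ^ 2 ≤ 4 * (σ 0 m : ℝ) / Δ := by
  have hΔ' : (0 : ℝ) < Δ := by exact_mod_cast hΔ
  calc ∑ d ∈ Ioc Δ N, (Nat.gcd m d : ℝ) / (d : ℝ) ^ 2
      ≤ ∑ d ∈ Ioc Δ N, (∑ e ∈ m.divisors.filter (· ∣ d), (e : ℝ)) / (d : ℝ) ^ 2 :=
        sum_le_sum fun d _ => div_le_div_of_nonneg_right (gcd_le_sum_divisors_filter_dvd hm d)
          (by positivity)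
    _ = ∑ d ∈ Ioc Δ N, ∑ e ∈ m.divisors, if e ∣ d then (e : ℝ) * ((d : ℝ) ^ 2)⁻¹ else 0 := by
        refine sum_congr rfl fun d _ => ?_
        rw [sum_filter, sum_div]
        refine sum_congr rfl fun e _ => ?_
        split_ifs <;> simp [div_eq_mul_inv]
    _ = ∑ e ∈ m.divisors, (e : ℝ) * ∑ d ∈ (Ioc Δ N).filter (e ∣ ·), ((d : ℝ) ^ 2)⁻¹ := by
        rw [sum_comm]
        refine sum_congr rfl fun e _ => ?_
        rw [sum_filter, mul_sum]
        refine sum_congr rfl fun d _ => ?_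
        split_ifs <;> simp
    _ ≤ ∑ e ∈ m.divisors, (e : ℝ) * (4 / (e * Δ)) := by
        refine sum_le_sum fun e he => ?_
        exact mul_le_mul_of_nonneg_left
          (sum_filter_dvd_inv_sq_le (Nat.pos_of_mem_divisors he) hΔ N) (Nat.cast_nonneg e)
    _ = ∑ e ∈ m.divisors, 4 / (Δ : ℝ) := by
        refine sum_congr rfl fun e he => ?_
        have he0 : (e : ℝ) ≠ 0 := by exact_mod_cast (Nat.pos_of_mem_divisors he).ne'
        field_simp
    _ = 4 * (σ 0 m : ℝ) / Δ := by
        rw [sum_const, nsmul_eq_mul, ArithmeticFunction.sigma_zero_apply]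
        ring

/-- The singular series `f_m(d) = μ(d)(m,d)/d²` is absolutely summable (`|f_m(d)| ≤ m/d²`).
[folklore] -/
theorem summable_norm_moebius_gcd_div_sq {m : ℕ} (hm : 0 < m) :
    Summable fun d : ℕ => ‖(ArithmeticFunction.moebius d : ℝ) * Nat.gcd m d / (d : ℝ) ^ 2‖ :=
  Summable.of_nonneg_of_le (fun _ => norm_nonneg _) (norm_moebius_gcd_div_sq_le hm)
    ((Real.summable_nat_pow_inv.mpr one_lt_two).mul_left (m : ℝ))

/-- **The tail of the singular series**: for `m, Δ ≥ 1`,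
`|∑_{d > Δ} μ(d)(m,d)/d²| ≤ 4τ(m)/Δ` (the series beyond `Δ`, as the shifted `tsum`).
[cite: HeathBrownActa2001, §5 (5.5)] -/
theorem abs_tsum_moebius_gcd_div_sq_tail_le {m Δ : ℕ} (hm : 0 < m) (hΔ : 0 < Δ) :
    |∑' i : ℕ, (ArithmeticFunction.moebius (i + (Δ + 1)) : ℝ) * Nat.gcd m (i + (Δ + 1)) /
        ((i + (Δ + 1) : ℕ) : ℝ) ^ 2| ≤ 4 * (σ 0 m : ℝ) / Δ := by
  set f : ℕ → ℝ := fun d => (ArithmeticFunction.moebius d : ℝ) * Nat.gcd m d / (d : ℝ) ^ 2 with hf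
  have hsum : Summable fun i => ‖f (i + (Δ + 1))‖ :=
    (summable_nat_add_iff (Δ + 1)).mpr (summable_norm_moebius_gcd_div_sq hm)
  change |∑' i : ℕ, f (i + (Δ + 1))| ≤ _
  rw [← Real.norm_eq_abs]
  refine (norm_tsum_le_tsum_norm hsum).trans ?_
  refine Real.tsum_le_of_sum_range_le (fun _ => norm_nonneg _) fun n => ?_
  calc ∑ i ∈ range n, ‖f (i + (Δ + 1))‖
      ≤ ∑ i ∈ range n, (Nat.gcd m (i + (Δ + 1)) : ℝ) / ((i + (Δ + 1) : ℕ) : ℝ) ^ 2 := by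
        refine sum_le_sum fun i _ => ?_
        simp only [hf, Real.norm_eq_abs, abs_div, abs_mul, Nat.abs_cast]
        rw [abs_of_nonneg (by positivity : (0 : ℝ) ≤ ((i + (Δ + 1) : ℕ) : ℝ) ^ 2)]
        refine div_le_div_of_nonneg_right ?_ (by positivity)
        have h1 : |(ArithmeticFunction.moebius (i + (Δ + 1)) : ℝ)| ≤ 1 := by
          exact_mod_cast ArithmeticFunction.abs_moebius_le_one
        calc |(ArithmeticFunction.moebius (i + (Δ + 1)) : ℝ)| * (Nat.gcd m (i + (Δ + 1)) : ℝ)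
            ≤ 1 * (Nat.gcd m (i + (Δ + 1)) : ℝ) :=
              mul_le_mul_of_nonneg_right h1 (Nat.cast_nonneg _)
          _ = _ := one_mul _
    _ = ∑ d ∈ Ico (Δ + 1) (Δ + 1 + n), (Nat.gcd m d : ℝ) / (d : ℝ) ^ 2 := by
        rw [sum_Ico_eq_sum_range, Nat.add_sub_cancel_left]
        refine sum_congr rfl fun i _ => ?_
        rw [add_comm]
    _ ≤ ∑ d ∈ Ioc Δ (Δ + n), (Nat.gcd m d : ℝ) / (d : ℝ) ^ 2 := by
        refine sum_le_sum_of_subset_of_nonneg (fun d hd => ?_) fun d _ _ => by positivity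
        rw [mem_Ico] at hd
        rw [mem_Ioc]
        omega
    _ ≤ 4 * (σ 0 m : ℝ) / Δ := sum_Ioc_gcd_div_sq_le hm hΔ _

/-- **Splitting the singular series at `Δ`**: for `m ≥ 1`,
`∑_{d ≥ 1} f_m(d) = ∑_{1 ≤ d ≤ Δ} f_m(d) + ∑_{d > Δ} f_m(d)` (`f_m(0) = 0`). [folklore] -/
theorem tsum_moebius_gcd_div_sq_eq_sum_add_tail {m : ℕ} (hm : 0 < m) (Δ : ℕ) :
    ∑' d : ℕ, (ArithmeticFunction.moebius d : ℝ) * Nat.gcd m d / (d : ℝ) ^ 2 =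
      ∑ d ∈ Icc 1 Δ, (ArithmeticFunction.moebius d : ℝ) * Nat.gcd m d / (d : ℝ) ^ 2 +
        ∑' i : ℕ, (ArithmeticFunction.moebius (i + (Δ + 1)) : ℝ) * Nat.gcd m (i + (Δ + 1)) /
          ((i + (Δ + 1) : ℕ) : ℝ) ^ 2 := by
  set f : ℕ → ℝ := fun d => (ArithmeticFunction.moebius d : ℝ) * Nat.gcd m d / (d : ℝ) ^ 2 with hf
  have hsum : Summable f := (summable_norm_moebius_gcd_div_sq hm).of_norm
  have h := hsum.sum_add_tsum_nat_add (Δ + 1)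
  change ∑' d, f d = ∑ d ∈ Icc 1 Δ, f d + ∑' i, f (i + (Δ + 1))
  rw [← h, Finset.range_eq_Ico, ← Finset.insert_Ico_add_one_left_eq_Ico (Nat.succ_pos Δ),
    sum_insert (by simp), show f 0 = 0 by simp [hf], zero_add]
  rfl

/-! ### Divisor-function bookkeeping for the tails (5.5), (5.6) and the head of (5.3) -/

open scoped Classical in
/-- **Lemma 4.2 over `K` with an extra factor `τ(N(R))^B`**: for every `A, B ≥ 0` there is `C` with
`∑_{0 < N(R) ≤ N} τ(R)^A τ(N(R))^B ≤ C N (log N)^{2^{4A+B+4}}` for all `N ≥ 2` (group by `n = N(R)`: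
`c_K(n) τ(R)^A τ(n)^B ≤ τ(n)^{4A+B+3}`, then the rational moments of `τ`,
`Literature.NumberTheory.Sieve.exists_sum_sigma_zero_pow_le`). [cite: HeathBrownActa2001, Lemma 4.2] -/
theorem exists_sum_idealDivisorCount_pow_mul_sigma_pow_le (A B : ℕ) :
    ∃ C : ℝ, 0 < C ∧ ∀ N : ℕ, 2 ≤ N →
      ∑ R ∈ (idealsLE N).filter (· ≠ ⊥),
          (idealDivisorCount R : ℝ) ^ A * (σ 0 (Ideal.absNorm R) : ℝ) ^ B ≤
        C * N * Real.log N ^ (2 ^ (4 * A + B + 4)) := by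
  obtain ⟨C, hC, h⟩ := exists_sum_sigma_zero_pow_le (4 * A + B + 3)
  refine ⟨C, hC, fun N hN => ?_⟩
  set S := (idealsLE N).filter (· ≠ ⊥) with hS
  have hmaps : ∀ R ∈ S, Ideal.absNorm R ∈ Icc 1 N := by
    intro R hR
    rw [hS, mem_filter, mem_idealsLE] at hR
    rw [mem_Icc]
    exact ⟨Nat.pos_of_ne_zero fun h0 => hR.2 (Ideal.absNorm_eq_zero_iff.mp h0), hR.1⟩
  calc ∑ R ∈ S, (idealDivisorCount R : ℝ) ^ A * (σ 0 (Ideal.absNorm R) : ℝ) ^ B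
      ≤ ∑ R ∈ S, (σ 0 (Ideal.absNorm R) : ℝ) ^ (4 * A + B) := by
        refine sum_le_sum fun R hR => ?_
        have hR0 : R ≠ ⊥ := (mem_filter.mp hR).2
        have h4 : (idealDivisorCount R : ℝ) ≤ (σ 0 (Ideal.absNorm R) : ℝ) ^ 4 := by
          exact_mod_cast idealDivisorCount_le_sigma_zero_pow_four hR0
        calc (idealDivisorCount R : ℝ) ^ A * (σ 0 (Ideal.absNorm R) : ℝ) ^ B
            ≤ ((σ 0 (Ideal.absNorm R) : ℝ) ^ 4) ^ A * (σ 0 (Ideal.absNorm R) : ℝ) ^ B :=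
              mul_le_mul_of_nonneg_right (pow_le_pow_left₀ (Nat.cast_nonneg _) h4 A) (by positivity)
          _ = (σ 0 (Ideal.absNorm R) : ℝ) ^ (4 * A + B) := by rw [← pow_mul, ← pow_add]
    _ = ∑ n ∈ Icc 1 N, ∑ R ∈ S with Ideal.absNorm R = n, (σ 0 n : ℝ) ^ (4 * A + B) :=
        (sum_fiberwise_of_maps_to' hmaps fun n : ℕ => (σ 0 n : ℝ) ^ (4 * A + B)).symm
    _ = ∑ n ∈ Icc 1 N, (LFunctions.idealNormCount K n : ℝ) * (σ 0 n : ℝ) ^ (4 * A + B) := by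
        refine sum_congr rfl fun n hn => ?_
        rw [sum_const, nsmul_eq_mul]
        congr 1
        have h2 : n ≤ N := (mem_Icc.mp hn).2
        exact_mod_cast card_filter_absNorm_eq (S := S) (d := n) fun D hD => by
          rw [hS, mem_filter, mem_idealsLE]
          refine ⟨hD ▸ h2, fun h0 => ?_⟩
          rw [h0, Ideal.absNorm_bot] at hD
          have h1 : 1 ≤ n := (mem_Icc.mp hn).1
          omega
    _ ≤ ∑ n ∈ Icc 1 N, (σ 0 n : ℝ) ^ (4 * A + B + 3) := by
        refine sum_le_sum fun n hn => ?_
        have h1 : n ≠ 0 := by have := (mem_Icc.mp hn).1; omega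
        have h3 : (LFunctions.idealNormCount K n : ℝ) ≤ (σ 0 n : ℝ) ^ 3 := by
          exact_mod_cast idealNormCount_le_sigma_zero_pow_three h1
        calc (LFunctions.idealNormCount K n : ℝ) * (σ 0 n : ℝ) ^ (4 * A + B)
            ≤ (σ 0 n : ℝ) ^ 3 * (σ 0 n : ℝ) ^ (4 * A + B) :=
              mul_le_mul_of_nonneg_right h3 (by positivity)
          _ = (σ 0 n : ℝ) ^ (4 * A + B + 3) := by ring
    _ ≤ C * N * Real.log N ^ (2 ^ (4 * A + B + 3 + 1)) := h N hN
    _ = C * N * Real.log N ^ (2 ^ (4 * A + B + 4)) := rfl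

open scoped Classical in
/-- **`∑_{R ∈ F, R ∣ J} τ(R)^A ≤ τ(J)^{A+1}`** for `J ≠ 0` and any finite set `F` of ideals: there are at
most `τ(J)` divisors, each with `τ(R) ≤ τ(J)`. [folklore] -/
theorem sum_filter_dvd_pow_le (F : Finset (Ideal (𝓞 K))) {J : Ideal (𝓞 K)} (hJ : J ≠ ⊥) (A : ℕ) :
    ∑ R ∈ F.filter (· ∣ J), (idealDivisorCount R : ℝ) ^ A ≤ (idealDivisorCount J : ℝ) ^ (A + 1) := by
  have hsub : F.filter (· ∣ J) ⊆ (idealsLE (Ideal.absNorm J)).filter (· ∣ J) := fun R hR =>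
    (mem_filter_dvd_idealsLE_iff hJ).mpr (mem_filter.mp hR).2
  calc ∑ R ∈ F.filter (· ∣ J), (idealDivisorCount R : ℝ) ^ A
      ≤ ∑ R ∈ F.filter (· ∣ J), (idealDivisorCount J : ℝ) ^ A := by
        refine sum_le_sum fun R hR => pow_le_pow_left₀ (Nat.cast_nonneg _) ?_ A
        exact_mod_cast idealDivisorCount_le_of_dvd hJ (mem_filter.mp hR).2
    _ = #(F.filter (· ∣ J)) * (idealDivisorCount J : ℝ) ^ A := by rw [sum_const, nsmul_eq_mul]
    _ ≤ (idealDivisorCount J : ℝ) * (idealDivisorCount J : ℝ) ^ A := by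
        refine mul_le_mul_of_nonneg_right ?_ (by positivity)
        exact_mod_cast card_le_card hsub
    _ = (idealDivisorCount J : ℝ) ^ (A + 1) := by ring

/-- `(d) ≠ 0` in `𝓞_K` for `d ≥ 1`. [folklore] -/
theorem span_natCast_ne_bot {d : ℕ} (hd : 0 < d) : Ideal.span {(d : 𝓞 K)} ≠ ⊥ := by
  rw [Ne, Ideal.span_singleton_eq_bot]
  exact_mod_cast hd.ne'

/-- **`τ((d)) ≤ τ(d)^{12}`** for the principal ideal `(d)`, `d ≥ 1`: `τ((d)) ≤ τ(N((d)))⁴ = τ(d³)⁴`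
and `τ(d³) ≤ τ(d)³`. [folklore] -/
theorem idealDivisorCount_span_natCast_le {d : ℕ} (hd : 0 < d) :
    idealDivisorCount (Ideal.span {(d : 𝓞 K)}) ≤ σ 0 d ^ 12 := by
  have h3 : σ 0 (d ^ 3) ≤ σ 0 d ^ 3 := by
    calc σ 0 (d ^ 3) = σ 0 (d * d * d) := by ring_nf
      _ ≤ σ 0 (d * d) * σ 0 d := sigma_zero_mul_le _ _
      _ ≤ σ 0 d * σ 0 d * σ 0 d := Nat.mul_le_mul_right _ (sigma_zero_mul_le _ _)
      _ = σ 0 d ^ 3 := by ring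
  calc idealDivisorCount (Ideal.span {(d : 𝓞 K)})
      ≤ σ 0 (Ideal.absNorm (Ideal.span {(d : 𝓞 K)})) ^ 4 :=
        idealDivisorCount_le_sigma_zero_pow_four (span_natCast_ne_bot hd)
    _ = σ 0 (d ^ 3) ^ 4 := by
        rw [Literature.NumberTheory.LFunctions.IdealNormCount.absNorm_span_natCast K d, finrank_K]
    _ ≤ (σ 0 d ^ 3) ^ 4 := Nat.pow_le_pow_left h3 4
    _ = σ 0 d ^ 12 := by ring

/-- **The box inside Lemma 4.7's range**: for `Y ≥ 0` and `s ≥ Y(1+η)`, the pairs of the box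
`(Y, Y(1+η)]²` are pairs of NONZERO integers of `[−s, s]²`, and `(x + y·2^{1/3})` is the ideal of
Lemma 4.7's summand, so `∑_{box} τ((x + y·2^{1/3}))^B` is at most the full sum of Lemma 4.7.
[cite: HeathBrownActa2001, §5 (5.6)] -/
theorem sum_latticeBox_le_sum_Icc {Y η s : ℝ} (hY : 0 ≤ Y) (hs : Y * (1 + η) ≤ s) (B : ℕ) :
    ∑ xy ∈ latticeBox Y η, (idealDivisorCount (pairIdeal xy) : ℝ) ^ B ≤
      ∑ m ∈ (Icc (-⌊s⌋) ⌊s⌋).filter (· ≠ 0), ∑ n ∈ (Icc (-⌊s⌋) ⌊s⌋).filter (· ≠ 0),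
        (idealDivisorCount (Ideal.span {((m : ℤ) : 𝓞 K) + ((n : ℤ) : 𝓞 K) * θint}) : ℝ) ^ B := by
  set F : Finset ℤ := (Icc (-⌊s⌋) ⌊s⌋).filter (· ≠ 0) with hF
  set g : ℤ × ℤ → ℝ := fun mn =>
    (idealDivisorCount (Ideal.span {((mn.1 : ℤ) : 𝓞 K) + ((mn.2 : ℤ) : 𝓞 K) * θint}) : ℝ) ^ B with hg
  set ι : ℕ × ℕ → ℤ × ℤ := fun xy => ((xy.1 : ℤ), (xy.2 : ℤ)) with hι
  have hιinj : Function.Injective ι := by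
    intro a b h
    simp only [hι, Prod.mk.injEq, Nat.cast_inj] at h
    exact Prod.ext h.1 h.2
  have hterm : ∀ xy : ℕ × ℕ, (idealDivisorCount (pairIdeal xy) : ℝ) ^ B = g (ι xy) := by
    intro xy
    simp only [hg, hι, pairIdeal, pairElt_eq_intCast]
  have hmemF : ∀ x : ℕ, Y < x → (x : ℝ) ≤ Y * (1 + η) → (x : ℤ) ∈ F := by
    intro x hx1 hx2
    have hxs : (x : ℝ) ≤ s := hx2.trans hs
    have hx0 : 0 < x := by exact_mod_cast hY.trans_lt hx1
    rw [hF, mem_filter, mem_Icc]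
    have hfl : (x : ℤ) ≤ ⌊s⌋ := Int.le_floor.mpr (by exact_mod_cast hxs)
    refine ⟨⟨?_, hfl⟩, by exact_mod_cast hx0.ne'⟩
    have : (0 : ℤ) ≤ x := by exact_mod_cast hx0.le
    linarith
  have hsub : (latticeBox Y η).image ι ⊆ F ×ˢ F := by
    intro z hz
    rw [mem_image] at hz
    obtain ⟨⟨x, y⟩, hxy, rfl⟩ := hz
    rw [mem_latticeBox_iff] at hxy
    obtain ⟨hx1, hx2, hy1, hy2⟩ := hxy
    exact mem_product.mpr ⟨hmemF x hx1 hx2, hmemF y hy1 hy2⟩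
  calc ∑ xy ∈ latticeBox Y η, (idealDivisorCount (pairIdeal xy) : ℝ) ^ B
      = ∑ xy ∈ latticeBox Y η, g (ι xy) := sum_congr rfl fun xy _ => hterm xy
    _ = ∑ z ∈ (latticeBox Y η).image ι, g z := (sum_image hιinj.injOn).symm
    _ ≤ ∑ z ∈ F ×ˢ F, g z := sum_le_sum_of_subset_of_nonneg hsub fun z _ _ => by positivity
    _ = ∑ m ∈ F, ∑ n ∈ F, g (m, n) := sum_product _ _ _

open scoped Classical in
/-- **Regrouping the tail (5.6) of the Möbius sum**: for a finite set `F` of ideals, `d ≥ 1` and a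
box with `Y ≥ 0`,
`∑_{R ∈ F} τ(R)^A #{(x,y) ∈ box : R ∣ (d)(x + y·2^{1/3})} ≤ τ((d))^{A+1} ∑_{(x,y) ∈ box} τ((x + y·2^{1/3}))^{A+1}`:
interchange, then `∑_{R ∣ J} τ(R)^A ≤ τ(J)^{A+1}` and `τ((d)·I) ≤ τ((d))τ(I)` (Lemma 4.3). (The paper
reaches `∑ τ(x + y·2^{1/3})^{c(A)}` through `R = ST`; the direct route gives the same shape.)
[cite: HeathBrownActa2001, §5 (5.6)] -/
theorem sum_pow_mul_card_filter_dvd_le (F : Finset (Ideal (𝓞 K))) {Y η : ℝ} (hY : 0 ≤ Y) {d : ℕ}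
    (hd : 0 < d) (A : ℕ) :
    ∑ R ∈ F, (idealDivisorCount R : ℝ) ^ A *
        #{xy ∈ latticeBox Y η | R ∣ Ideal.span {(d : 𝓞 K)} * pairIdeal xy} ≤
      (idealDivisorCount (Ideal.span {(d : 𝓞 K)}) : ℝ) ^ (A + 1) *
        ∑ xy ∈ latticeBox Y η, (idealDivisorCount (pairIdeal xy) : ℝ) ^ (A + 1) := by
  set J : ℕ × ℕ → Ideal (𝓞 K) := fun xy => Ideal.span {(d : 𝓞 K)} * pairIdeal xy with hJ
  have hswap : ∑ R ∈ F, (idealDivisorCount R : ℝ) ^ A * #{xy ∈ latticeBox Y η | R ∣ J xy} =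
      ∑ xy ∈ latticeBox Y η, ∑ R ∈ F.filter (· ∣ J xy), (idealDivisorCount R : ℝ) ^ A := by
    have h1 : ∀ R ∈ F, (idealDivisorCount R : ℝ) ^ A * #{xy ∈ latticeBox Y η | R ∣ J xy} =
        ∑ xy ∈ latticeBox Y η, if R ∣ J xy then (idealDivisorCount R : ℝ) ^ A else 0 := by
      intro R _
      rw [← sum_boole, mul_sum]
      refine sum_congr rfl fun xy _ => ?_
      split_ifs <;> simp
    rw [sum_congr rfl h1, sum_comm]
    refine sum_congr rfl fun xy _ => ?_
    rw [sum_filter]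
  rw [hswap, mul_sum]
  refine sum_le_sum fun xy hxy => ?_
  rw [mem_latticeBox_iff] at hxy
  have hx : xy.1 ≠ 0 := by
    rintro h0
    have h := hxy.1
    rw [h0, Nat.cast_zero] at h
    linarith
  have hI0 : pairIdeal xy ≠ ⊥ := pairIdeal_ne_bot (Or.inl hx)
  have hJ0 : J xy ≠ ⊥ := mul_ne_zero (span_natCast_ne_bot hd) hI0
  calc ∑ R ∈ F.filter (· ∣ J xy), (idealDivisorCount R : ℝ) ^ A
      ≤ (idealDivisorCount (J xy) : ℝ) ^ (A + 1) := sum_filter_dvd_pow_le F hJ0 A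
    _ ≤ ((idealDivisorCount (Ideal.span {(d : 𝓞 K)}) : ℝ) * idealDivisorCount (pairIdeal xy)) ^ (A + 1) := by
        refine pow_le_pow_left₀ (Nat.cast_nonneg _) ?_ _
        exact_mod_cast idealDivisorCount_mul_le (span_natCast_ne_bot hd) hI0
    _ = _ := mul_pow _ _ _

/-! ### Regrouping the head of (5.3) by `S = (R, d)`, `R = ST` (p. 32) -/

/-- The cofactor of `(R, d)` in `R`: an ideal `T` with `R = (R ⊔ (d))·T` (it exists since
`R ⊔ (d) ⊇ R`; for `R ∈ 𝒯r` it is Heath-Brown's `R/(R, d)`). Proof-internal choice. [folklore] -/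
theorem exists_eq_sup_mul (R : Ideal (𝓞 K)) (a : 𝓞 K) : ∃ T : Ideal (𝓞 K), R = (R ⊔ Ideal.span {a}) * T :=
  Ideal.dvd_iff_le.mpr le_sup_left

open scoped Classical in
/-- **The head of (5.3) regrouped by `S = (R, d)`** (p. 32: "If we now write `S = (R, d)` and
`R = ST` once more …"): for `d ≥ 1` and `Q > 0`,
`∑_{Q<N(R)≤2Q, R∈𝒯r} τ(R)^A |#{box(X/d) : R ∣ (d)·I} − η²X²N((R,d))/(d²N(R))|
   ≤ ∑_{S ∣ (d)} τ(S)^A ∑_{Q/N(S)<N(T)≤2Q/N(S), T∈𝒯r} τ(T)^A |S(T; X/d) − η²(X/d)²/N(T)|`,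
since `R ↦ T = R/(R,d)` is injective on each fibre `{(R,d) = S}`, `R ∣ (d)·I ⟺ T ∣ I`
(`dvd_span_mul_iff`), `N(R) = N(S)N(T)` and `τ(R) ≤ τ(S)τ(T)` (Lemma 4.3). The inner sums are those
of Lemma 5.1 at `(X/d, Q/N(S))`. [cite: HeathBrownActa2001, §5 p. 32] -/
theorem sum_trBlock_head_le (X η : ℝ) {Q : ℝ} (hQ : 0 < Q) {d : ℕ} (hd : 0 < d) (A : ℕ) :
    ∑ R ∈ (idealsLE ⌊2 * Q⌋₊).filter (fun R => Q < (Ideal.absNorm R : ℝ) ∧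
        (Ideal.absNorm R : ℝ) ≤ 2 * Q ∧ Squarefree (Ideal.absNorm R)),
      (idealDivisorCount R : ℝ) ^ A *
        |(#{xy ∈ latticeBox (X / d) η | R ∣ Ideal.span {(d : 𝓞 K)} * pairIdeal xy} : ℝ) -
          η ^ 2 * X ^ 2 * Ideal.absNorm (R ⊔ Ideal.span {(d : 𝓞 K)}) /
            ((d : ℝ) ^ 2 * Ideal.absNorm R)| ≤
    ∑ S ∈ (idealsLE (Ideal.absNorm (Ideal.span {(d : 𝓞 K)}))).filter (· ∣ Ideal.span {(d : 𝓞 K)}),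
      (idealDivisorCount S : ℝ) ^ A *
        ∑ T ∈ (idealsLE ⌊2 * (Q / Ideal.absNorm S)⌋₊).filter (fun T =>
            Q / Ideal.absNorm S < (Ideal.absNorm T : ℝ) ∧
              (Ideal.absNorm T : ℝ) ≤ 2 * (Q / Ideal.absNorm S) ∧ Squarefree (Ideal.absNorm T)),
          (idealDivisorCount T : ℝ) ^ A *
            |(latticeCount (X / d) η T : ℝ) - η ^ 2 * (X / d) ^ 2 / Ideal.absNorm T| := by
  set Sd : Ideal (𝓞 K) := Ideal.span {(d : 𝓞 K)} with hSd
  have hSd0 : Sd ≠ ⊥ := span_natCast_ne_bot hd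
  set tr : ℝ → Finset (Ideal (𝓞 K)) := fun Q' => (idealsLE ⌊2 * Q'⌋₊).filter (fun R =>
    Q' < (Ideal.absNorm R : ℝ) ∧ (Ideal.absNorm R : ℝ) ≤ 2 * Q' ∧ Squarefree (Ideal.absNorm R)) with htr
  set Dv := (idealsLE (Ideal.absNorm Sd)).filter (· ∣ Sd) with hDv
  set G : Ideal (𝓞 K) → ℝ := fun T => (idealDivisorCount T : ℝ) ^ A *
    |(latticeCount (X / d) η T : ℝ) - η ^ 2 * (X / d) ^ 2 / Ideal.absNorm T| with hG
  -- the cofactor `T = R/(R,d)`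
  set e : Ideal (𝓞 K) → Ideal (𝓞 K) := fun R => Classical.choose (exists_eq_sup_mul R (d : 𝓞 K)) with he
  have he_spec : ∀ R, R = (R ⊔ Sd) * e R := fun R => Classical.choose_spec (exists_eq_sup_mul R (d : 𝓞 K))
  -- fibre decomposition by `S = R ⊔ (d)`
  have hmaps : ∀ R ∈ tr Q, R ⊔ Sd ∈ Dv := fun R _ =>
    (mem_filter_dvd_idealsLE_iff hSd0).mpr (Ideal.dvd_iff_le.mpr le_sup_right)
  change ∑ R ∈ tr Q, (idealDivisorCount R : ℝ) ^ A * _ ≤ ∑ S ∈ Dv, (idealDivisorCount S : ℝ) ^ A * ∑ T ∈ tr (Q / Ideal.absNorm S), G T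
  rw [← sum_fiberwise_of_maps_to hmaps]
  refine sum_le_sum fun S hS => ?_
  have hS0 : S ≠ ⊥ := by
    rintro rfl
    exact hSd0 (zero_dvd_iff.mp ((mem_filter_dvd_idealsLE_iff hSd0).mp hS))
  have hNS : (0 : ℝ) < Ideal.absNorm S := by
    have : Ideal.absNorm S ≠ 0 := fun h => hS0 (Ideal.absNorm_eq_zero_iff.mp h)
    positivity
  -- properties of members of the fibre
  have hfib : ∀ R ∈ (tr Q).filter (fun R => R ⊔ Sd = S),
      R = S * e R ∧ Squarefree (Ideal.absNorm R) ∧ Q < (Ideal.absNorm R : ℝ) ∧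
        (Ideal.absNorm R : ℝ) ≤ 2 * Q := by
    intro R hR
    rw [mem_filter, htr, mem_filter] at hR
    obtain ⟨⟨-, hQ1, hQ2, hsq⟩, hRS⟩ := hR
    refine ⟨?_, hsq, hQ1, hQ2⟩
    have h := he_spec R
    rwa [hRS] at h
  have hmem : ∀ R ∈ (tr Q).filter (fun R => R ⊔ Sd = S), e R ∈ tr (Q / Ideal.absNorm S) := by
    intro R hR
    obtain ⟨hRST, hsq, hQ1, hQ2⟩ := hfib R hR
    have hNRnat : Ideal.absNorm R = Ideal.absNorm S * Ideal.absNorm (e R) := by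
      have h := congr_arg Ideal.absNorm hRST
      rwa [map_mul] at h
    have hNR : (Ideal.absNorm R : ℝ) = Ideal.absNorm S * Ideal.absNorm (e R) := by
      exact_mod_cast hNRnat
    have hNT1 : Q / Ideal.absNorm S < Ideal.absNorm (e R) := by
      rw [div_lt_iff₀' hNS, ← hNR]; exact hQ1
    have hNT2 : (Ideal.absNorm (e R) : ℝ) ≤ 2 * (Q / Ideal.absNorm S) := by
      rw [mul_div_assoc', le_div_iff₀' hNS, ← hNR]; exact hQ2
    rw [htr, mem_filter, mem_idealsLE]
    refine ⟨Nat.le_floor hNT2, hNT1, hNT2, ?_⟩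
    exact Squarefree.squarefree_of_dvd ⟨Ideal.absNorm S, by rw [hNRnat, mul_comm]⟩ hsq
  have hinj : Set.InjOn e ↑((tr Q).filter (fun R => R ⊔ Sd = S)) := by
    intro R₁ h₁ R₂ h₂ h12
    rw [mem_coe] at h₁ h₂
    rw [(hfib R₁ h₁).1, (hfib R₂ h₂).1, h12]
  -- pointwise comparison of the summands
  have hpt : ∀ R ∈ (tr Q).filter (fun R => R ⊔ Sd = S),
      (idealDivisorCount R : ℝ) ^ A *
        |(#{xy ∈ latticeBox (X / d) η | R ∣ Sd * pairIdeal xy} : ℝ) -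
          η ^ 2 * X ^ 2 * Ideal.absNorm (R ⊔ Sd) / ((d : ℝ) ^ 2 * Ideal.absNorm R)| ≤
        (idealDivisorCount S : ℝ) ^ A * G (e R) := by
    intro R hR
    obtain ⟨hRST, hsq, hQ1, -⟩ := hfib R hR
    have hRS : R ⊔ Sd = S := (mem_filter.mp hR).2
    have hR0 : R ≠ ⊥ := by
      rintro rfl
      rw [Ideal.absNorm_bot, Nat.cast_zero] at hQ1
      linarith
    have hT0 : e R ≠ ⊥ := by
      intro h0
      rw [h0, Ideal.mul_bot] at hRST
      exact hR0 hRST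
    have hcop : IsCoprime (e R) Sd := by
      refine isCoprime_span_of_eq_sup_mul (squarefree_of_squarefree_absNorm hsq) ?_
      rw [hRS]; exact hRST
    have hRST' : R = (R ⊔ Sd) * e R := by rw [hRS]; exact hRST
    -- the count
    have hcount : #{xy ∈ latticeBox (X / d) η | R ∣ Sd * pairIdeal xy} = latticeCount (X / d) η (e R) := by
      rw [latticeCount]
      congr 1
      exact filter_congr fun xy _ => dvd_span_mul_iff hRST' hcop
    -- the main term
    have hNR : (Ideal.absNorm R : ℝ) = Ideal.absNorm S * Ideal.absNorm (e R) := by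
      have h := congr_arg Ideal.absNorm hRST
      rw [map_mul] at h
      exact_mod_cast h
    have hNT : (0 : ℝ) < Ideal.absNorm (e R) := by
      have : Ideal.absNorm (e R) ≠ 0 := fun h => hT0 (Ideal.absNorm_eq_zero_iff.mp h)
      positivity
    have hd' : (0 : ℝ) < d := by exact_mod_cast hd
    have hmain : η ^ 2 * X ^ 2 * Ideal.absNorm (R ⊔ Sd) / ((d : ℝ) ^ 2 * Ideal.absNorm R) =
        η ^ 2 * (X / d) ^ 2 / Ideal.absNorm (e R) := by
      rw [hRS, hNR]
      field_simp
    rw [hcount, hmain, hG]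
    simp only
    rw [← mul_assoc]
    refine mul_le_mul_of_nonneg_right ?_ (abs_nonneg _)
    rw [← mul_pow]
    refine pow_le_pow_left₀ (Nat.cast_nonneg _) ?_ A
    have hτ : idealDivisorCount R ≤ idealDivisorCount S * idealDivisorCount (e R) := by
      have h := idealDivisorCount_mul_le hS0 hT0
      rwa [← hRST] at h
    exact_mod_cast hτ
  calc ∑ R ∈ (tr Q).filter (fun R => R ⊔ Sd = S), (idealDivisorCount R : ℝ) ^ A *
          |(#{xy ∈ latticeBox (X / d) η | R ∣ Sd * pairIdeal xy} : ℝ) -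
            η ^ 2 * X ^ 2 * Ideal.absNorm (R ⊔ Sd) / ((d : ℝ) ^ 2 * Ideal.absNorm R)|
      ≤ ∑ R ∈ (tr Q).filter (fun R => R ⊔ Sd = S), (idealDivisorCount S : ℝ) ^ A * G (e R) :=
        sum_le_sum hpt
    _ = (idealDivisorCount S : ℝ) ^ A * ∑ T ∈ ((tr Q).filter (fun R => R ⊔ Sd = S)).image e, G T := by
        rw [mul_sum, sum_image hinj]
    _ ≤ (idealDivisorCount S : ℝ) ^ A * ∑ T ∈ tr (Q / Ideal.absNorm S), G T := by
        refine mul_le_mul_of_nonneg_left ?_ (by positivity)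
        refine sum_le_sum_of_subset_of_nonneg (fun T hT => ?_) fun T _ _ => by positivity
        rw [mem_image] at hT
        obtain ⟨R, hR, rfl⟩ := hT
        exact hmem R hR

/-! ### The error of one `R ∈ 𝒯r`, split at `Δ` (p. 31) -/

open scoped Classical in
/-- **Splitting the error at `Δ`** (p. 31: "We shall split the sums (5.3) and (5.4) at `d = Δ`"):
for `R ∈ 𝒯r`, `X ≥ 0`, `1 ≤ Δ ≤ D` and `D ≥ ⌊X(1+η)⌋`,
`|#𝒜^(K)_R − (6η²X²/π²)ρ₂(R)/N(R)| ≤ ∑_{d ≤ Δ} |S_d(R) − η²X²N((R,d))/(d²N(R))| + ∑_{Δ<d≤D} S_d(R)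
  + (η²X²/N(R)) · 4τ(N(R))/Δ`,
where `S_d(R) = #{x', y' ∈ (X/d, X(1+η)/d] : R ∣ (d)(x' + y'·2^{1/3})}`: by (5.3)
`#𝒜^(K)_R = ∑_{d ≤ D} μ(d) S_d(R)`, by (5.4) the main term is `(η²X²/N(R)) ∑_{d≥1} μ(d)(N(R),d)/d²`
with `(N(R), d) = N((R,d))`, and the tail `d > Δ` of the series is at most `4τ(N(R))/Δ`
(`abs_tsum_moebius_gcd_div_sq_tail_le`). [cite: HeathBrownActa2001, §5 pp. 31–32] -/
theorem abs_countA_sub_mainTerm_le {X η : ℝ} (hX : 0 ≤ X) {R : Ideal (𝓞 K)}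
    (hR : Squarefree (Ideal.absNorm R)) {Δ D : ℕ} (hΔ : 0 < Δ) (hΔD : Δ ≤ D)
    (hD : ⌊X * (1 + η)⌋₊ ≤ D) :
    |(countA X η R : ℝ) - 6 * η ^ 2 * X ^ 2 / Real.pi ^ 2 * rho₂ R / Ideal.absNorm R| ≤
      ∑ d ∈ Icc 1 Δ,
          |(#{xy ∈ latticeBox (X / d) η | R ∣ Ideal.span {(d : 𝓞 K)} * pairIdeal xy} : ℝ) -
            η ^ 2 * X ^ 2 * Ideal.absNorm (R ⊔ Ideal.span {(d : 𝓞 K)}) /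
              ((d : ℝ) ^ 2 * Ideal.absNorm R)| +
        ∑ d ∈ Ioc Δ D,
          (#{xy ∈ latticeBox (X / d) η | R ∣ Ideal.span {(d : 𝓞 K)} * pairIdeal xy} : ℝ) +
        η ^ 2 * X ^ 2 / Ideal.absNorm R * (4 * σ 0 (Ideal.absNorm R) / Δ) := by
  set m := Ideal.absNorm R with hmdef
  have hm : 0 < m := Nat.pos_of_ne_zero hR.ne_zero
  have hm' : (0 : ℝ) < m := by exact_mod_cast hm
  set L : ℕ → ℝ := fun d =>
    (#{xy ∈ latticeBox (X / d) η | R ∣ Ideal.span {(d : 𝓞 K)} * pairIdeal xy} : ℝ) with hL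
  set M : ℕ → ℝ := fun d =>
    η ^ 2 * X ^ 2 * Ideal.absNorm (R ⊔ Ideal.span {(d : 𝓞 K)}) / ((d : ℝ) ^ 2 * m) with hM
  set f : ℕ → ℝ := fun d => (ArithmeticFunction.moebius d : ℝ) * Nat.gcd m d / (d : ℝ) ^ 2 with hf
  set Tail : ℝ := ∑' i : ℕ, f (i + (Δ + 1)) with hTail
  -- (5.3)
  have h53 : (countA X η R : ℝ) = ∑ d ∈ Icc 1 D, (ArithmeticFunction.moebius d : ℝ) * L d := by
    have h := congr_arg (Int.cast : ℤ → ℝ) (countA_eq_sum_moebius hX R hD)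
    push_cast at h
    exact h
  -- (5.4)
  have h54 : 6 * η ^ 2 * X ^ 2 / Real.pi ^ 2 * rho₂ R / m =
      ∑ d ∈ Icc 1 Δ, (ArithmeticFunction.moebius d : ℝ) * M d + η ^ 2 * X ^ 2 / m * Tail := by
    have hmt := mainTerm_eq_tsum hR
    rw [tsum_moebius_gcd_div_sq_eq_sum_add_tail hm Δ] at hmt
    have hMd : ∀ d ∈ Icc 1 Δ, (ArithmeticFunction.moebius d : ℝ) * M d = η ^ 2 * X ^ 2 / m * f d := by
      intro d hd
      have hd0 : (0 : ℝ) < d := by exact_mod_cast (mem_Icc.mp hd).1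
      simp only [hM, hf]
      rw [absNorm_sup_span_natCast hR d, ← hmdef]
      field_simp
    rw [sum_congr rfl hMd, ← mul_sum, ← mul_add]
    calc 6 * η ^ 2 * X ^ 2 / Real.pi ^ 2 * rho₂ R / m
        = η ^ 2 * X ^ 2 * (6 / Real.pi ^ 2 * rho₂ R / m) := by ring
      _ = η ^ 2 * X ^ 2 * ((m : ℝ)⁻¹ * (∑ d ∈ Icc 1 Δ, f d + Tail)) := by rw [hmt]
      _ = η ^ 2 * X ^ 2 / m * (∑ d ∈ Icc 1 Δ, f d + Tail) := by ring
  -- split the Möbius sum at `Δ`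
  have hsplit : ∑ d ∈ Icc 1 D, (ArithmeticFunction.moebius d : ℝ) * L d =
      ∑ d ∈ Icc 1 Δ, (ArithmeticFunction.moebius d : ℝ) * L d +
        ∑ d ∈ Ioc Δ D, (ArithmeticFunction.moebius d : ℝ) * L d := by
    rw [← Finset.Ico_add_one_right_eq_Icc 1 D, ← Finset.Ico_add_one_right_eq_Icc 1 Δ,
      ← Finset.Ico_add_one_add_one_eq_Ioc Δ D]
    exact (sum_Ico_consecutive _ (by omega) (by omega)).symm
  -- the identity
  have hid : (countA X η R : ℝ) - 6 * η ^ 2 * X ^ 2 / Real.pi ^ 2 * rho₂ R / m =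
      ∑ d ∈ Icc 1 Δ, (ArithmeticFunction.moebius d : ℝ) * (L d - M d) +
        ∑ d ∈ Ioc Δ D, (ArithmeticFunction.moebius d : ℝ) * L d - η ^ 2 * X ^ 2 / m * Tail := by
    rw [h53, h54, hsplit]
    simp only [mul_sub, sum_sub_distrib]
    ring
  -- the three bounds
  have hμ : ∀ d : ℕ, |(ArithmeticFunction.moebius d : ℝ)| ≤ 1 := fun d => by
    exact_mod_cast ArithmeticFunction.abs_moebius_le_one
  have hLnn : ∀ d, 0 ≤ L d := fun d => by simp only [hL]; positivity
  have h1 : |∑ d ∈ Icc 1 Δ, (ArithmeticFunction.moebius d : ℝ) * (L d - M d)| ≤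
      ∑ d ∈ Icc 1 Δ, |L d - M d| := by
    refine (abs_sum_le_sum_abs _ _).trans (sum_le_sum fun d _ => ?_)
    rw [abs_mul]
    calc |(ArithmeticFunction.moebius d : ℝ)| * |L d - M d| ≤ 1 * |L d - M d| :=
          mul_le_mul_of_nonneg_right (hμ d) (abs_nonneg _)
      _ = |L d - M d| := one_mul _
  have h2 : |∑ d ∈ Ioc Δ D, (ArithmeticFunction.moebius d : ℝ) * L d| ≤ ∑ d ∈ Ioc Δ D, L d := by
    refine (abs_sum_le_sum_abs _ _).trans (sum_le_sum fun d _ => ?_)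
    rw [abs_mul, abs_of_nonneg (hLnn d)]
    calc |(ArithmeticFunction.moebius d : ℝ)| * L d ≤ 1 * L d :=
          mul_le_mul_of_nonneg_right (hμ d) (hLnn d)
      _ = L d := one_mul _
  have h3 : |η ^ 2 * X ^ 2 / m * Tail| ≤ η ^ 2 * X ^ 2 / m * (4 * σ 0 m / Δ) := by
    rw [abs_mul, abs_of_nonneg (by positivity : (0 : ℝ) ≤ η ^ 2 * X ^ 2 / m)]
    exact mul_le_mul_of_nonneg_left (abs_tsum_moebius_gcd_div_sq_tail_le hm hΔ) (by positivity)
  rw [hid]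
  calc |∑ d ∈ Icc 1 Δ, (ArithmeticFunction.moebius d : ℝ) * (L d - M d) +
          ∑ d ∈ Ioc Δ D, (ArithmeticFunction.moebius d : ℝ) * L d - η ^ 2 * X ^ 2 / m * Tail|
      ≤ |∑ d ∈ Icc 1 Δ, (ArithmeticFunction.moebius d : ℝ) * (L d - M d)| +
          |∑ d ∈ Ioc Δ D, (ArithmeticFunction.moebius d : ℝ) * L d| + |η ^ 2 * X ^ 2 / m * Tail| := by
        refine (abs_sub _ _).trans ?_
        linarith [abs_add_le (∑ d ∈ Icc 1 Δ, (ArithmeticFunction.moebius d : ℝ) * (L d - M d))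
          (∑ d ∈ Ioc Δ D, (ArithmeticFunction.moebius d : ℝ) * L d)]
    _ ≤ _ := add_le_add (add_le_add h1 h2) h3

/-! ### The three pieces of the sum over `R`: head (Lemma 5.1), tail (5.6) (Lemma 4.7), tail (5.5) -/

open scoped Classical in
/-- **The head `d ≤ Δ` for one `d`** (p. 32): granted the estimate of Lemma 5.1 with constants
`c₁, C₁ ≥ 0` (uniform in `0 < η ≤ 1`, `Q > 0`), for `1 ≤ d ≤ X`,
`∑_{Q<N(R)≤2Q, R∈𝒯r} τ(R)^A |S_d(R) − η²X²N((R,d))/(d²N(R))| ≤ C₁ log(Q+2)^{c₁} (X/d + Q) τ(d)^{12(A+1)}`: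
regroup by `S = (R, d)` (`sum_trBlock_head_le`), apply Lemma 5.1 at `(X/d, Q/N(S))`, and use
`∑_{S ∣ (d)} τ(S)^A ≤ τ((d))^{A+1} ≤ τ(d)^{12(A+1)}`. [cite: HeathBrownActa2001, §5 p. 32] -/
theorem head_term_le {A : ℕ} {c₁ C₁ : ℝ} (hc₁ : 0 ≤ c₁) (hC₁ : 0 ≤ C₁)
    (h51 : ∀ X η Q : ℝ, 1 ≤ X → 0 < η → η ≤ 1 → 0 < Q →
      ∑ R ∈ (idealsLE ⌊2 * Q⌋₊).filter (fun R => Q < (Ideal.absNorm R : ℝ) ∧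
          (Ideal.absNorm R : ℝ) ≤ 2 * Q ∧ Squarefree (Ideal.absNorm R)),
        (idealDivisorCount R : ℝ) ^ A * |(latticeCount X η R : ℝ) - η ^ 2 * X ^ 2 / Ideal.absNorm R| ≤
      C₁ * (X + Q) * Real.log (Q + 2) ^ c₁)
    {X η Q : ℝ} {d : ℕ} (hd : 0 < d) (hdX : (d : ℝ) ≤ X) (hη0 : 0 < η) (hη1 : η ≤ 1) (hQ : 0 < Q) :
    ∑ R ∈ (idealsLE ⌊2 * Q⌋₊).filter (fun R => Q < (Ideal.absNorm R : ℝ) ∧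
        (Ideal.absNorm R : ℝ) ≤ 2 * Q ∧ Squarefree (Ideal.absNorm R)),
      (idealDivisorCount R : ℝ) ^ A *
        |(#{xy ∈ latticeBox (X / d) η | R ∣ Ideal.span {(d : 𝓞 K)} * pairIdeal xy} : ℝ) -
          η ^ 2 * X ^ 2 * Ideal.absNorm (R ⊔ Ideal.span {(d : 𝓞 K)}) /
            ((d : ℝ) ^ 2 * Ideal.absNorm R)| ≤
    C₁ * Real.log (Q + 2) ^ c₁ * (X / d + Q) * (σ 0 d : ℝ) ^ (12 * (A + 1)) := by
  have hd' : (0 : ℝ) < d := by exact_mod_cast hd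
  have hXd : 1 ≤ X / d := by rw [le_div_iff₀ hd']; linarith
  refine (sum_trBlock_head_le X η hQ hd A).trans ?_
  set Sd : Ideal (𝓞 K) := Ideal.span {(d : 𝓞 K)} with hSd
  have hSd0 : Sd ≠ ⊥ := span_natCast_ne_bot hd
  -- the inner sums by Lemma 5.1
  have hinner : ∀ S ∈ (idealsLE (Ideal.absNorm Sd)).filter (· ∣ Sd),
      (idealDivisorCount S : ℝ) ^ A *
        ∑ T ∈ (idealsLE ⌊2 * (Q / Ideal.absNorm S)⌋₊).filter (fun T =>
            Q / Ideal.absNorm S < (Ideal.absNorm T : ℝ) ∧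
              (Ideal.absNorm T : ℝ) ≤ 2 * (Q / Ideal.absNorm S) ∧ Squarefree (Ideal.absNorm T)),
          (idealDivisorCount T : ℝ) ^ A *
            |(latticeCount (X / d) η T : ℝ) - η ^ 2 * (X / d) ^ 2 / Ideal.absNorm T| ≤
      (idealDivisorCount S : ℝ) ^ A * (C₁ * Real.log (Q + 2) ^ c₁ * (X / d + Q)) := by
    intro S hS
    have hS0 : S ≠ ⊥ := by
      rintro rfl
      exact hSd0 (zero_dvd_iff.mp ((mem_filter_dvd_idealsLE_iff hSd0).mp hS))
    have hNS1 : (1 : ℝ) ≤ Ideal.absNorm S := by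
      have : Ideal.absNorm S ≠ 0 := fun h => hS0 (Ideal.absNorm_eq_zero_iff.mp h)
      exact_mod_cast Nat.one_le_iff_ne_zero.mpr this
    have hQS : 0 < Q / Ideal.absNorm S := div_pos hQ (by linarith)
    have hQS' : Q / Ideal.absNorm S ≤ Q := div_le_self hQ.le hNS1
    refine mul_le_mul_of_nonneg_left ((h51 (X / d) η (Q / Ideal.absNorm S) hXd hη0 hη1 hQS).trans ?_)
      (by positivity)
    have hlog : Real.log (Q / Ideal.absNorm S + 2) ^ c₁ ≤ Real.log (Q + 2) ^ c₁ :=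
      Real.rpow_le_rpow (Real.log_nonneg (by linarith)) (Real.log_le_log (by linarith) (by linarith)) hc₁
    calc C₁ * (X / d + Q / Ideal.absNorm S) * Real.log (Q / Ideal.absNorm S + 2) ^ c₁
        ≤ C₁ * (X / d + Q) * Real.log (Q + 2) ^ c₁ := by
          refine mul_le_mul ?_ hlog (Real.rpow_nonneg (Real.log_nonneg (by linarith)) _)
            (by positivity)
          exact mul_le_mul_of_nonneg_left (by linarith) hC₁
      _ = C₁ * Real.log (Q + 2) ^ c₁ * (X / d + Q) := by ring
  refine (sum_le_sum hinner).trans ?_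
  rw [← sum_mul]
  have hτ : ∑ S ∈ (idealsLE (Ideal.absNorm Sd)).filter (· ∣ Sd), (idealDivisorCount S : ℝ) ^ A ≤
      (σ 0 d : ℝ) ^ (12 * (A + 1)) := by
    refine (sum_filter_dvd_pow_le _ hSd0 A).trans ?_
    rw [pow_mul]
    refine pow_le_pow_left₀ (Nat.cast_nonneg _) ?_ _
    exact_mod_cast idealDivisorCount_span_natCast_le hd
  have hK : 0 ≤ C₁ * Real.log (Q + 2) ^ c₁ * (X / d + Q) := by
    have : 0 ≤ Real.log (Q + 2) ^ c₁ := Real.rpow_nonneg (Real.log_nonneg (by linarith)) _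
    positivity
  calc (∑ S ∈ (idealsLE (Ideal.absNorm Sd)).filter (· ∣ Sd), (idealDivisorCount S : ℝ) ^ A) *
        (C₁ * Real.log (Q + 2) ^ c₁ * (X / d + Q))
      ≤ (σ 0 d : ℝ) ^ (12 * (A + 1)) * (C₁ * Real.log (Q + 2) ^ c₁ * (X / d + Q)) :=
        mul_le_mul_of_nonneg_right hτ hK
    _ = _ := by ring

open scoped Classical in
/-- **The tail (5.6) for one `d`** (p. 31): granted the estimate of Lemma 4.7 for the exponent `A+1`
with constants `c₂, C₂`, for every finite set `F` of ideals, `X ≥ 0` and `d ≥ 1`,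
`∑_{R ∈ F} τ(R)^A S_d(R) ≤ τ(d)^{12(A+1)} · C₂ s² log(s²)^{c₂}` with `s = max(2, X(1+η)/d)`:
`∑_R τ(R)^A S_d(R) ≤ τ((d))^{A+1} ∑_{box(X/d)} τ((x+y·2^{1/3}))^{A+1}` (`sum_pow_mul_card_filter_dvd_le`),
the box lies in Lemma 4.7's range `[−s, s]²` (`sum_latticeBox_le_sum_Icc`), and
`τ((d)) ≤ τ(d)^{12}`. [cite: HeathBrownActa2001, §5 (5.6)] -/
theorem tail56_term_le {A : ℕ} {c₂ C₂ : ℝ}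
    (h47 : ∀ x y : ℝ, 2 ≤ x → 2 ≤ y →
      ∑ m ∈ (Icc (-⌊x⌋) ⌊x⌋).filter (· ≠ 0), ∑ n ∈ (Icc (-⌊y⌋) ⌊y⌋).filter (· ≠ 0),
        (idealDivisorCount (Ideal.span {((m : ℤ) : 𝓞 K) + ((n : ℤ) : 𝓞 K) * θint}) : ℝ) ^ (A + 1) ≤
      C₂ * x * y * Real.log (x * y) ^ c₂)
    (F : Finset (Ideal (𝓞 K))) {X η : ℝ} (hX : 0 ≤ X) {d : ℕ} (hd : 0 < d) :
    ∑ R ∈ F, (idealDivisorCount R : ℝ) ^ A *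
        #{xy ∈ latticeBox (X / d) η | R ∣ Ideal.span {(d : 𝓞 K)} * pairIdeal xy} ≤
      (σ 0 d : ℝ) ^ (12 * (A + 1)) *
        (C₂ * max 2 (X * (1 + η) / d) * max 2 (X * (1 + η) / d) *
          Real.log (max 2 (X * (1 + η) / d) * max 2 (X * (1 + η) / d)) ^ c₂) := by
  set s : ℝ := max 2 (X * (1 + η) / d) with hs
  have hs2 : 2 ≤ s := le_max_left _ _
  have hd' : (0 : ℝ) < d := by exact_mod_cast hd
  have hY : 0 ≤ X / d := by positivity
  have hYs : X / d * (1 + η) ≤ s := by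
    rw [div_mul_eq_mul_div]
    exact le_max_right _ _
  refine (sum_pow_mul_card_filter_dvd_le F hY hd A).trans ?_
  have hbox := (sum_latticeBox_le_sum_Icc hY hYs (A + 1)).trans (h47 s s hs2 hs2)
  have hτ : (idealDivisorCount (Ideal.span {(d : 𝓞 K)}) : ℝ) ^ (A + 1) ≤ (σ 0 d : ℝ) ^ (12 * (A + 1)) := by
    rw [pow_mul]
    refine pow_le_pow_left₀ (Nat.cast_nonneg _) ?_ _
    exact_mod_cast idealDivisorCount_span_natCast_le hd
  have hsum0 : 0 ≤ ∑ xy ∈ latticeBox (X / d) η, (idealDivisorCount (pairIdeal xy) : ℝ) ^ (A + 1) :=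
    sum_nonneg fun _ _ => by positivity
  exact mul_le_mul hτ hbox hsum0 (by positivity)

open scoped Classical in
/-- **The tail (5.5) of the singular series, summed over `R`**: for every `A` there is `C` with
`∑_{Q<N(R)≤2Q, R∈𝒯r} τ(R)^A · (η²X²/N(R)) · 4τ(N(R))/Δ ≤ C X² log(2Q)^{2^{4A+5}}/Δ` for all `X`,
`0 ≤ η ≤ 1`, `Q ≥ 1`, `Δ ≥ 1` (`N(R) > Q` and Lemma 4.2 over `K` with the extra factor `τ(N(R))`,
`exists_sum_idealDivisorCount_pow_mul_sigma_pow_le`). (The paper's (5.5) gives the same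
`η²X²Δ^{-1}(log Q)^{c(A)}`.) [cite: HeathBrownActa2001, §5 (5.5)] -/
theorem exists_tail55_le (A : ℕ) :
    ∃ C : ℝ, 0 < C ∧ ∀ X η Q : ℝ, 0 ≤ η → η ≤ 1 → 1 ≤ Q → ∀ Δ : ℕ, 0 < Δ →
      ∑ R ∈ (idealsLE ⌊2 * Q⌋₊).filter (fun R => Q < (Ideal.absNorm R : ℝ) ∧
          (Ideal.absNorm R : ℝ) ≤ 2 * Q ∧ Squarefree (Ideal.absNorm R)),
        (idealDivisorCount R : ℝ) ^ A *
          (η ^ 2 * X ^ 2 / Ideal.absNorm R * (4 * σ 0 (Ideal.absNorm R) / Δ)) ≤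
      C * X ^ 2 * Real.log (2 * Q) ^ (2 ^ (4 * A + 5)) / Δ := by
  obtain ⟨C₃, hC₃, h42⟩ := exists_sum_idealDivisorCount_pow_mul_sigma_pow_le A 1
  refine ⟨8 * C₃, by positivity, fun X η Q hη0 hη1 hQ Δ hΔ => ?_⟩
  have hQ0 : 0 < Q := by linarith
  have hΔ' : (0 : ℝ) < Δ := by exact_mod_cast hΔ
  set M : ℕ := ⌊2 * Q⌋₊ with hM
  have hM2 : 2 ≤ M := Nat.le_floor (by push_cast; linarith)
  have hMQ : (M : ℝ) ≤ 2 * Q := Nat.floor_le (by positivity)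
  have hM1 : (1 : ℝ) ≤ M := by exact_mod_cast le_trans (by norm_num) hM2
  set F := (idealsLE M).filter (fun R => Q < (Ideal.absNorm R : ℝ) ∧
    (Ideal.absNorm R : ℝ) ≤ 2 * Q ∧ Squarefree (Ideal.absNorm R)) with hF
  -- pointwise
  have hpt : ∀ R ∈ F, (idealDivisorCount R : ℝ) ^ A *
      (η ^ 2 * X ^ 2 / Ideal.absNorm R * (4 * σ 0 (Ideal.absNorm R) / Δ)) ≤
        4 * X ^ 2 / (Q * Δ) * ((idealDivisorCount R : ℝ) ^ A * (σ 0 (Ideal.absNorm R) : ℝ) ^ 1) := by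
    intro R hR
    rw [hF, mem_filter] at hR
    obtain ⟨-, hQR, -, -⟩ := hR
    have hNR : (0 : ℝ) < Ideal.absNorm R := hQ0.trans hQR
    have hη2 : η ^ 2 ≤ 1 := by nlinarith
    rw [pow_one]
    have key : η ^ 2 * X ^ 2 / Ideal.absNorm R * (4 * σ 0 (Ideal.absNorm R) / Δ) ≤
        4 * X ^ 2 / (Q * Δ) * σ 0 (Ideal.absNorm R) := by
      rw [div_mul_div_comm, div_le_iff₀ (by positivity)]
      calc η ^ 2 * X ^ 2 * (4 * (σ 0 (Ideal.absNorm R) : ℝ))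
          ≤ 1 * X ^ 2 * (4 * (σ 0 (Ideal.absNorm R) : ℝ)) := by gcongr
        _ = 4 * X ^ 2 / (Q * Δ) * σ 0 (Ideal.absNorm R) * (Q * Δ) := by field_simp
        _ ≤ 4 * X ^ 2 / (Q * Δ) * σ 0 (Ideal.absNorm R) * (Ideal.absNorm R * Δ) := by
            gcongr
    calc (idealDivisorCount R : ℝ) ^ A * (η ^ 2 * X ^ 2 / Ideal.absNorm R * (4 * σ 0 (Ideal.absNorm R) / Δ))
        ≤ (idealDivisorCount R : ℝ) ^ A * (4 * X ^ 2 / (Q * Δ) * σ 0 (Ideal.absNorm R)) :=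
          mul_le_mul_of_nonneg_left key (by positivity)
      _ = _ := by ring
  have hsub : F ⊆ (idealsLE M).filter (· ≠ ⊥) := by
    intro R hR
    rw [hF, mem_filter] at hR
    obtain ⟨hRM, hQR, -⟩ := hR
    refine mem_filter.mpr ⟨hRM, fun h0 => ?_⟩
    rw [h0, Ideal.absNorm_bot, Nat.cast_zero] at hQR
    linarith
  have hlogM : Real.log M ≤ Real.log (2 * Q) := Real.log_le_log (by positivity) hMQ
  have hlogM0 : 0 ≤ Real.log M := Real.log_nonneg hM1
  calc ∑ R ∈ F, (idealDivisorCount R : ℝ) ^ A *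
          (η ^ 2 * X ^ 2 / Ideal.absNorm R * (4 * σ 0 (Ideal.absNorm R) / Δ))
      ≤ ∑ R ∈ F, 4 * X ^ 2 / (Q * Δ) *
          ((idealDivisorCount R : ℝ) ^ A * (σ 0 (Ideal.absNorm R) : ℝ) ^ 1) := sum_le_sum hpt
    _ = 4 * X ^ 2 / (Q * Δ) *
          ∑ R ∈ F, (idealDivisorCount R : ℝ) ^ A * (σ 0 (Ideal.absNorm R) : ℝ) ^ 1 := by rw [mul_sum]
    _ ≤ 4 * X ^ 2 / (Q * Δ) *
          ∑ R ∈ (idealsLE M).filter (· ≠ ⊥), (idealDivisorCount R : ℝ) ^ A * (σ 0 (Ideal.absNorm R) : ℝ) ^ 1 := by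
        refine mul_le_mul_of_nonneg_left ?_ (by positivity)
        exact sum_le_sum_of_subset_of_nonneg hsub fun R _ _ => by positivity
    _ ≤ 4 * X ^ 2 / (Q * Δ) * (C₃ * M * Real.log M ^ (2 ^ (4 * A + 1 + 4))) :=
        mul_le_mul_of_nonneg_left (h42 M hM2) (by positivity)
    _ ≤ 4 * X ^ 2 / (Q * Δ) * (C₃ * (2 * Q) * Real.log (2 * Q) ^ (2 ^ (4 * A + 1 + 4))) := by
        gcongr
    _ = 8 * C₃ * X ^ 2 * Real.log (2 * Q) ^ (2 ^ (4 * A + 5)) / Δ := by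
        field_simp
        ring_nf

/-! ### Numerical bookkeeping: the parameter `Δ = 1 + min(X^{1/2}, XQ^{-1/2})` and the logarithms -/

/-- Powers of `L ≥ log 2` with exponent `γ ≤ c` are at most `(log 2)^{-c} L^c`. [folklore] -/
theorem rpow_le_inv_log_two_pow_mul {L γ c : ℝ} (hL : Real.log 2 ≤ L) (hγ : 0 ≤ γ) (hγc : γ ≤ c) :
    L ^ γ ≤ (Real.log 2)⁻¹ ^ c * L ^ c := by
  have hl2 : 0 < Real.log 2 := Real.log_pos one_lt_two
  have hL0 : 0 < L := hl2.trans_le hL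
  have h1 : L ^ γ = L ^ c * L ^ (γ - c) := by
    rw [← Real.rpow_add hL0]; ring_nf
  rw [h1, mul_comm]
  refine mul_le_mul_of_nonneg_right ?_ (Real.rpow_nonneg hL0.le _)
  calc L ^ (γ - c) ≤ (Real.log 2) ^ (γ - c) :=
        Real.rpow_le_rpow_of_nonpos hl2 hL (by linarith)
    _ = (Real.log 2)⁻¹ ^ (c - γ) := by
        rw [Real.inv_rpow hl2.le, ← Real.rpow_neg hl2.le]; ring_nf
    _ ≤ (Real.log 2)⁻¹ ^ c := by
        refine Real.rpow_le_rpow_of_exponent_le ?_ (by linarith)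
        rw [le_inv_comm₀ one_pos hl2, inv_one]
        exact (Real.log_le_sub_one_of_pos two_pos).trans (by norm_num)

/-- The logarithms occurring in the proof of Lemma 3.2, against `L = log(QX)` (`X ≥ 2`, `Q ≥ 1`):
`log 2, log X, log 2Q ≤ L`, `log(Q+2), log 2X ≤ 2L`, `log(2 + 2X^{1/2}) ≤ 3L`, `log(8X²) ≤ 5L`.
[folklore] -/
theorem log_bounds {X Q : ℝ} (hX : 2 ≤ X) (hQ : 1 ≤ Q) :
    Real.log 2 ≤ Real.log (Q * X) ∧ Real.log X ≤ Real.log (Q * X) ∧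
      Real.log (2 * Q) ≤ Real.log (Q * X) ∧ Real.log (Q + 2) ≤ 2 * Real.log (Q * X) ∧
      Real.log (2 * X) ≤ 2 * Real.log (Q * X) ∧
      Real.log (2 + 2 * Real.sqrt X) ≤ 3 * Real.log (Q * X) ∧
      Real.log (8 * X ^ 2) ≤ 5 * Real.log (Q * X) := by
  have hX0 : 0 < X := by linarith
  have hQ0 : 0 < Q := by linarith
  have hl2 : 0 < Real.log 2 := Real.log_pos one_lt_two
  have hlX : Real.log 2 ≤ Real.log X := Real.log_le_log two_pos hX
  have hlQ : 0 ≤ Real.log Q := Real.log_nonneg hQ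
  have hL : Real.log (Q * X) = Real.log Q + Real.log X := Real.log_mul hQ0.ne' hX0.ne'
  have hsqrt : Real.sqrt X ≤ X := by
    rw [Real.sqrt_le_left (by linarith)]
    nlinarith
  refine ⟨?_, ?_, ?_, ?_, ?_, ?_, ?_⟩
  · rw [hL]; linarith
  · rw [hL]; linarith
  · rw [Real.log_mul two_ne_zero hQ0.ne', hL]; linarith
  · calc Real.log (Q + 2) ≤ Real.log (Q * X * (Q * X)) := by
          refine Real.log_le_log (by linarith) ?_
          nlinarith [mul_le_mul hQ hX zero_le_two hQ0.le]
      _ = 2 * Real.log (Q * X) := by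
          rw [Real.log_mul (by positivity) (by positivity)]; ring
  · rw [Real.log_mul two_ne_zero hX0.ne', hL]; linarith
  · calc Real.log (2 + 2 * Real.sqrt X) ≤ Real.log (X * X * X) := by
          refine Real.log_le_log (by positivity) ?_
          nlinarith [Real.sqrt_nonneg X]
      _ = 3 * Real.log X := by
          rw [Real.log_mul (by positivity) hX0.ne', Real.log_mul hX0.ne' hX0.ne']; ring
      _ ≤ 3 * Real.log (Q * X) := by rw [hL]; linarith
  · calc Real.log (8 * X ^ 2) = 3 * Real.log 2 + 2 * Real.log X := by
          rw [Real.log_mul (by norm_num) (by positivity), Real.log_pow,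
            show (8 : ℝ) = 2 ^ 3 by norm_num, Real.log_pow]
          push_cast; ring
      _ ≤ 5 * Real.log (Q * X) := by rw [hL]; linarith

/-- **The parameter `Δ = 1 + min(X^{1/2}, XQ^{-1/2})`** (p. 32, "essentially optimal") and its
integer part `Δ₀ = ⌊Δ⌋`: for `X ≥ 2`, `Q ≥ 1`: `1 ≤ Δ₀ ≤ Δ ≤ 2Δ₀`, `Δ₀ ≤ X`, `Δ ≤ 1 + X^{1/2}`,
`X²/Δ ≤ X^{3/2} + XQ^{1/2}` and `QΔ ≤ Q + XQ^{1/2}` — the two inequalities that turn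
`(X + QΔ) + X²/Δ` into `Q + XQ^{1/2} + X^{3/2}`. [cite: HeathBrownActa2001, §5 p. 32] -/
theorem delta_bounds {X Q : ℝ} (hX : 2 ≤ X) (hQ : 1 ≤ Q) :
    1 ≤ ⌊1 + min (Real.sqrt X) (X / Real.sqrt Q)⌋₊ ∧
    (⌊1 + min (Real.sqrt X) (X / Real.sqrt Q)⌋₊ : ℝ) ≤ 1 + min (Real.sqrt X) (X / Real.sqrt Q) ∧
    1 + min (Real.sqrt X) (X / Real.sqrt Q) ≤ 2 * ⌊1 + min (Real.sqrt X) (X / Real.sqrt Q)⌋₊ ∧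
    (⌊1 + min (Real.sqrt X) (X / Real.sqrt Q)⌋₊ : ℝ) ≤ X ∧
    1 + min (Real.sqrt X) (X / Real.sqrt Q) ≤ 1 + Real.sqrt X ∧
    X ^ 2 / (1 + min (Real.sqrt X) (X / Real.sqrt Q)) ≤ X ^ (3 / 2 : ℝ) + X * Real.sqrt Q ∧
    Q * (1 + min (Real.sqrt X) (X / Real.sqrt Q)) ≤ Q + X * Real.sqrt Q := by
  set μ : ℝ := min (Real.sqrt X) (X / Real.sqrt Q) with hμ
  set Δ : ℝ := 1 + μ with hΔ
  have hX0 : 0 < X := by linarith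
  have hQ0 : 0 < Q := by linarith
  have hsX : 0 < Real.sqrt X := Real.sqrt_pos.mpr hX0
  have hsQ : 0 < Real.sqrt Q := Real.sqrt_pos.mpr hQ0
  have hsQ1 : 1 ≤ Real.sqrt Q := by rw [Real.le_sqrt' one_pos]; linarith
  have hμ0 : 0 < μ := lt_min hsX (div_pos hX0 hsQ)
  have hΔ1 : 1 ≤ Δ := by rw [hΔ]; linarith
  have hΔ0 : 0 ≤ Δ := by linarith
  have hfloor1 : 1 ≤ ⌊Δ⌋₊ := Nat.le_floor (by exact_mod_cast hΔ1)
  have hfloor_le : (⌊Δ⌋₊ : ℝ) ≤ Δ := Nat.floor_le hΔ0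
  have hsqX : Real.sqrt X * Real.sqrt X = X := Real.mul_self_sqrt hX0.le
  have hsqQ : Real.sqrt Q * Real.sqrt Q = Q := Real.mul_self_sqrt hQ0.le
  refine ⟨hfloor1, hfloor_le, ?_, ?_, by rw [hΔ]; linarith [min_le_left (Real.sqrt X) (X / Real.sqrt Q)], ?_, ?_⟩
  · -- `Δ ≤ 2⌊Δ⌋`
    have hlt : Δ < ⌊Δ⌋₊ + 1 := Nat.lt_floor_add_one Δ
    have h1 : (1 : ℝ) ≤ ⌊Δ⌋₊ := by exact_mod_cast hfloor1
    linarith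
  · -- `⌊Δ⌋ ≤ X`
    by_cases h4 : 4 ≤ X
    · have h2 : 2 ≤ Real.sqrt X := by rw [Real.le_sqrt' two_pos]; linarith
      have hΔle : Δ ≤ 1 + Real.sqrt X := by
        rw [hΔ]; linarith [min_le_left (Real.sqrt X) (X / Real.sqrt Q)]
      nlinarith
    · rw [not_le] at h4
      have h2 : Real.sqrt X < 2 := by
        rw [Real.sqrt_lt' two_pos]; linarith
      have hΔ3 : Δ < 3 := by
        have : μ ≤ Real.sqrt X := min_le_left _ _
        rw [hΔ]; linarith
      have hfl : ⌊Δ⌋₊ < 3 := (Nat.floor_lt hΔ0).mpr (by exact_mod_cast hΔ3)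
      have : (⌊Δ⌋₊ : ℝ) ≤ 2 := by exact_mod_cast Nat.lt_succ_iff.mp hfl
      linarith
  · -- `X²/Δ ≤ X^{3/2} + X√Q`
    have hX32 : X ^ (3 / 2 : ℝ) = X * Real.sqrt X := by
      rw [show (3 / 2 : ℝ) = 1 + 1 / 2 by norm_num, Real.rpow_add hX0, Real.rpow_one,
        Real.sqrt_eq_rpow]
    have hXs : X ^ 2 / Real.sqrt X = X * Real.sqrt X := by
      rw [eq_comm, eq_div_iff hsX.ne']; nlinarith [hsqX]
    have hXq : X ^ 2 / (X / Real.sqrt Q) = X * Real.sqrt Q := by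
      field_simp
    have hle : X ^ 2 / Δ ≤ X ^ 2 / μ :=
      div_le_div_of_nonneg_left (by positivity) hμ0 (by rw [hΔ]; linarith)
    refine hle.trans ?_
    rw [hX32]
    rcases le_total (Real.sqrt X) (X / Real.sqrt Q) with h | h
    · rw [hμ, min_eq_left h, hXs]
      have : 0 ≤ X * Real.sqrt Q := by positivity
      linarith
    · rw [hμ, min_eq_right h, hXq]
      have : 0 ≤ X * Real.sqrt X := by positivity
      linarith
  · -- `QΔ ≤ Q + X√Q`
    have hμle : μ ≤ X / Real.sqrt Q := min_le_right _ _
    have hQμ : Q * μ ≤ Q * (X / Real.sqrt Q) := mul_le_mul_of_nonneg_left hμle hQ0.le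
    have hQX : Q * (X / Real.sqrt Q) = X * Real.sqrt Q := by
      field_simp
      nlinarith [hsqQ]
    rw [hΔ, mul_add, mul_one]
    linarith

/-! ### The three pieces summed over `d` -/

open scoped Classical in
/-- **The head, summed over `d ≤ Δ₀`** (p. 32: "the overall contribution from terms of (5.3) and
(5.4) with `d ≤ Δ` is `≪ (X + Q)(log Q)^{c(A)} ∑_{d≤Δ} τ(d)^{c}`"): granted Lemma 5.1 (constants
`c₁, C₁`) and the rational moments `∑_{n≤x} τ(n)^B/n ≤ C₄(log x)^k`, `∑_{n≤x} τ(n)^B ≤ C₅ x(log x)^k`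
(`B = 12(A+1)`, any exponent `k`), for `X ≥ 2`, `0 < η ≤ 1`, `Q ≥ 1` and `1 ≤ Δ₀ ≤ X` with `log max(2, Δ₀) ≤ 3 log QX`
and `QΔ₀ ≤ Q + XQ^{1/2}`, the head is at most
`C₁ 2^{c₁} 3^k (C₄ + 2C₅) · (Q + XQ^{1/2} + X^{3/2}) · (log QX)^{c₁ + k}`. [cite: HeathBrownActa2001, §5 p. 32] -/
theorem head_total_le {A k : ℕ} {c₁ C₁ C₄ C₅ : ℝ} (hc₁ : 0 ≤ c₁) (hC₁ : 0 ≤ C₁) (hC₄ : 0 ≤ C₄)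
    (hC₅ : 0 ≤ C₅)
    (h51 : ∀ X η Q : ℝ, 1 ≤ X → 0 < η → η ≤ 1 → 0 < Q →
      ∑ R ∈ (idealsLE ⌊2 * Q⌋₊).filter (fun R => Q < (Ideal.absNorm R : ℝ) ∧
          (Ideal.absNorm R : ℝ) ≤ 2 * Q ∧ Squarefree (Ideal.absNorm R)),
        (idealDivisorCount R : ℝ) ^ A * |(latticeCount X η R : ℝ) - η ^ 2 * X ^ 2 / Ideal.absNorm R| ≤
      C₁ * (X + Q) * Real.log (Q + 2) ^ c₁)
    (H4div : ∀ x : ℝ, 2 ≤ x → ∑ n ∈ Icc 1 ⌊x⌋₊, (σ 0 n : ℝ) ^ (12 * (A + 1)) / n ≤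
      C₄ * Real.log x ^ k)
    (H4 : ∀ x : ℝ, 2 ≤ x → ∑ n ∈ Icc 1 ⌊x⌋₊, (σ 0 n : ℝ) ^ (12 * (A + 1)) ≤ C₅ * x * Real.log x ^ k)
    {X η Q : ℝ} (hX : 2 ≤ X) (hη0 : 0 < η) (hη1 : η ≤ 1) (hQ : 1 ≤ Q) {Δ₀ : ℕ} (hΔ₀ : 0 < Δ₀)
    (hΔ₀X : (Δ₀ : ℝ) ≤ X) (hx₁ : Real.log (max 2 (Δ₀ : ℝ)) ≤ 3 * Real.log (Q * X))
    (hQΔ₀ : Q * Δ₀ ≤ Q + X * Real.sqrt Q) :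
    ∑ d ∈ Icc 1 Δ₀, ∑ R ∈ (idealsLE ⌊2 * Q⌋₊).filter (fun R => Q < (Ideal.absNorm R : ℝ) ∧
        (Ideal.absNorm R : ℝ) ≤ 2 * Q ∧ Squarefree (Ideal.absNorm R)),
      (idealDivisorCount R : ℝ) ^ A *
        |(#{xy ∈ latticeBox (X / d) η | R ∣ Ideal.span {(d : 𝓞 K)} * pairIdeal xy} : ℝ) -
          η ^ 2 * X ^ 2 * Ideal.absNorm (R ⊔ Ideal.span {(d : 𝓞 K)}) /
            ((d : ℝ) ^ 2 * Ideal.absNorm R)| ≤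
    C₁ * 2 ^ c₁ * 3 ^ (k : ℝ) * (C₄ + 2 * C₅) *
      (Q + X * Real.sqrt Q + X ^ (3 / 2 : ℝ)) * Real.log (Q * X) ^ (c₁ + k) := by
  set B : ℕ := 12 * (A + 1) with hB
  set L : ℝ := Real.log (Q * X) with hL
  set Lq : ℝ := Real.log (Q + 2) with hLq
  set x₁ : ℝ := max 2 (Δ₀ : ℝ) with hx₁def
  have hX0 : 0 < X := by linarith
  have hQ0 : 0 < Q := by linarith
  obtain ⟨hl2L, hlXL, -, hlQ2L, -, -, -⟩ := log_bounds hX hQ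
  have hl2 : 0 < Real.log 2 := Real.log_pos one_lt_two
  have hL0 : 0 < L := hl2.trans_le hl2L
  have hLq0 : 0 ≤ Lq := Real.log_nonneg (by linarith)
  have hx₁2 : 2 ≤ x₁ := le_max_left _ _
  have hlx₁0 : 0 ≤ Real.log x₁ := Real.log_nonneg (by linarith)
  have hΔ₀x₁ : Δ₀ ≤ ⌊x₁⌋₊ := Nat.le_floor (le_max_right _ _)
  -- each `d`
  have hterm : ∀ d ∈ Icc 1 Δ₀, ∑ R ∈ (idealsLE ⌊2 * Q⌋₊).filter (fun R => Q < (Ideal.absNorm R : ℝ) ∧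
        (Ideal.absNorm R : ℝ) ≤ 2 * Q ∧ Squarefree (Ideal.absNorm R)),
      (idealDivisorCount R : ℝ) ^ A *
        |(#{xy ∈ latticeBox (X / d) η | R ∣ Ideal.span {(d : 𝓞 K)} * pairIdeal xy} : ℝ) -
          η ^ 2 * X ^ 2 * Ideal.absNorm (R ⊔ Ideal.span {(d : 𝓞 K)}) /
            ((d : ℝ) ^ 2 * Ideal.absNorm R)| ≤
      C₁ * Lq ^ c₁ * (X * ((σ 0 d : ℝ) ^ B / d) + Q * (σ 0 d : ℝ) ^ B) := by
    intro d hd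
    rw [mem_Icc] at hd
    have hd0 : 0 < d := hd.1
    have hdX : (d : ℝ) ≤ X := le_trans (by exact_mod_cast hd.2) hΔ₀X
    refine (head_term_le hc₁ hC₁ h51 hd0 hdX hη0 hη1 hQ0).trans (le_of_eq ?_)
    rw [hB]
    ring
  refine (sum_le_sum hterm).trans ?_
  rw [← mul_sum, sum_add_distrib, ← mul_sum, ← mul_sum]
  -- the rational moments over `d ≤ Δ₀ ≤ x₁`
  have hsub : Icc 1 Δ₀ ⊆ Icc 1 ⌊x₁⌋₊ := Icc_subset_Icc le_rfl hΔ₀x₁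
  have hdiv : ∑ d ∈ Icc 1 Δ₀, (σ 0 d : ℝ) ^ B / d ≤ C₄ * Real.log x₁ ^ k :=
    (sum_le_sum_of_subset_of_nonneg hsub fun d _ _ => by positivity).trans (H4div x₁ hx₁2)
  have hmom : ∑ d ∈ Icc 1 Δ₀, (σ 0 d : ℝ) ^ B ≤ C₅ * x₁ * Real.log x₁ ^ k :=
    (sum_le_sum_of_subset_of_nonneg hsub fun d _ _ => by positivity).trans (H4 x₁ hx₁2)
  -- logarithms and `x₁`
  have hlogx₁ : Real.log x₁ ^ k ≤ (3 * L) ^ k := pow_le_pow_left₀ hlx₁0 hx₁ k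
  have hLq : Lq ^ c₁ ≤ (2 * L) ^ c₁ := Real.rpow_le_rpow hLq0 hlQ2L hc₁
  have hx₁Δ : x₁ ≤ 2 * Δ₀ := by
    have h1 : (1 : ℝ) ≤ Δ₀ := by exact_mod_cast hΔ₀
    exact max_le (by linarith) (by linarith)
  have hQx₁ : Q * x₁ ≤ 2 * (Q + X * Real.sqrt Q) := by
    calc Q * x₁ ≤ Q * (2 * Δ₀) := mul_le_mul_of_nonneg_left hx₁Δ hQ0.le
      _ = 2 * (Q * Δ₀) := by ring
      _ ≤ 2 * (Q + X * Real.sqrt Q) := by linarith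
  -- `P`
  set P : ℝ := Q + X * Real.sqrt Q + X ^ (3 / 2 : ℝ) with hP
  have hX32 : X ≤ X ^ (3 / 2 : ℝ) := by
    calc X = X ^ (1 : ℝ) := (Real.rpow_one X).symm
      _ ≤ X ^ (3 / 2 : ℝ) := Real.rpow_le_rpow_of_exponent_le (by linarith) (by norm_num)
  have hsq0 : 0 ≤ X * Real.sqrt Q := by positivity
  have hXP : X ≤ P := by rw [hP]; linarith
  have hQP : Q + X * Real.sqrt Q ≤ P := by
    rw [hP]; linarith [Real.rpow_nonneg hX0.le (3 / 2 : ℝ)]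
  have hP0 : 0 ≤ P := by linarith
  -- assemble
  have h3k : (3 * L) ^ k = 3 ^ (k : ℝ) * L ^ (k : ℝ) := by
    rw [mul_pow, ← Real.rpow_natCast, ← Real.rpow_natCast]
  have h2c : (2 * L) ^ c₁ = 2 ^ c₁ * L ^ c₁ := Real.mul_rpow zero_le_two hL0.le
  have hLck : L ^ c₁ * L ^ (k : ℝ) = L ^ (c₁ + k) := by rw [← Real.rpow_add hL0]
  calc C₁ * Lq ^ c₁ * (X * ∑ d ∈ Icc 1 Δ₀, (σ 0 d : ℝ) ^ B / d + Q * ∑ d ∈ Icc 1 Δ₀, (σ 0 d : ℝ) ^ B)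
      ≤ C₁ * (2 * L) ^ c₁ * (X * (C₄ * (3 * L) ^ k) + Q * (C₅ * x₁ * (3 * L) ^ k)) := by
        have h1 : X * ∑ d ∈ Icc 1 Δ₀, (σ 0 d : ℝ) ^ B / d ≤ X * (C₄ * (3 * L) ^ k) :=
          mul_le_mul_of_nonneg_left (hdiv.trans (mul_le_mul_of_nonneg_left hlogx₁ hC₄)) hX0.le
        have h2 : Q * ∑ d ∈ Icc 1 Δ₀, (σ 0 d : ℝ) ^ B ≤ Q * (C₅ * x₁ * (3 * L) ^ k) :=
          mul_le_mul_of_nonneg_left (hmom.trans (mul_le_mul_of_nonneg_left hlogx₁ (by positivity)))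
            hQ0.le
        have h0 : 0 ≤ X * (C₄ * (3 * L) ^ k) + Q * (C₅ * x₁ * (3 * L) ^ k) := by positivity
        calc C₁ * Lq ^ c₁ * (X * ∑ d ∈ Icc 1 Δ₀, (σ 0 d : ℝ) ^ B / d + Q * ∑ d ∈ Icc 1 Δ₀, (σ 0 d : ℝ) ^ B)
            ≤ C₁ * Lq ^ c₁ * (X * (C₄ * (3 * L) ^ k) + Q * (C₅ * x₁ * (3 * L) ^ k)) :=
              mul_le_mul_of_nonneg_left (add_le_add h1 h2) (by positivity)
          _ ≤ C₁ * (2 * L) ^ c₁ * (X * (C₄ * (3 * L) ^ k) + Q * (C₅ * x₁ * (3 * L) ^ k)) :=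
              mul_le_mul_of_nonneg_right (mul_le_mul_of_nonneg_left hLq hC₁) h0
    _ = C₁ * (2 * L) ^ c₁ * (3 * L) ^ k * (C₄ * X + C₅ * (Q * x₁)) := by ring
    _ ≤ C₁ * (2 * L) ^ c₁ * (3 * L) ^ k * (C₄ * P + C₅ * (2 * P)) := by
        refine mul_le_mul_of_nonneg_left (add_le_add (mul_le_mul_of_nonneg_left hXP hC₄)
          (mul_le_mul_of_nonneg_left (hQx₁.trans (by linarith)) hC₅)) (by positivity)
    _ = C₁ * 2 ^ c₁ * 3 ^ (k : ℝ) * (C₄ + 2 * C₅) * P * L ^ (c₁ + k) := by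
        rw [h2c, h3k, ← hLck]; ring

open scoped Classical in
/-- **The tail (5.6), summed over `Δ₀ < d ≤ D'`** (p. 31: "`≪ ∑_{Δ<d≪X} τ(d)^{c(A)} (X²/d²)(log X)^{c(A)}
≪ X²Δ^{-1}(log X)^{c(A)}`"): granted Lemma 4.7 for the exponent `A+1` (constants `c₂, C₂`) and the
rational moments of `τ^B` (`B = 12(A+1)`, any exponent `k`), for `X ≥ 2`, `0 ≤ η ≤ 1`, `Q ≥ 1`,
`1 ≤ Δ₀`, `2 ≤ D' ≤ 2X`, `0 < Δ ≤ 2Δ₀` with `X²/Δ ≤ X^{3/2} + XQ^{1/2}`, and any finite set `F` of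
ideals, `∑_{Δ₀<d≤D'} ∑_{R∈F} τ(R)^A S_d(R) ≤ C₂ 5^{c₂} 2^k (8C₅ + 8C₄)·(Q + XQ^{1/2} + X^{3/2})·(log QX)^{c₂+k}`
(for `d ≤ X` the box has side `≤ 2X/d`, for `d > X` side `2`; in both cases
`side² ≤ 4 + 4X²/d²`, `log side² ≤ log 8X²`). [cite: HeathBrownActa2001, §5 (5.6)] -/
theorem tail56_total_le {A k : ℕ} {c₂ C₂ C₄ C₅ : ℝ} (hc₂ : 0 ≤ c₂) (hC₂ : 0 ≤ C₂) (hC₄ : 0 ≤ C₄)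
    (hC₅ : 0 ≤ C₅)
    (h47 : ∀ x y : ℝ, 2 ≤ x → 2 ≤ y →
      ∑ m ∈ (Icc (-⌊x⌋) ⌊x⌋).filter (· ≠ 0), ∑ n ∈ (Icc (-⌊y⌋) ⌊y⌋).filter (· ≠ 0),
        (idealDivisorCount (Ideal.span {((m : ℤ) : 𝓞 K) + ((n : ℤ) : 𝓞 K) * θint}) : ℝ) ^ (A + 1) ≤
      C₂ * x * y * Real.log (x * y) ^ c₂)
    (H4div : ∀ x : ℝ, 2 ≤ x → ∑ n ∈ Icc 1 ⌊x⌋₊, (σ 0 n : ℝ) ^ (12 * (A + 1)) / n ≤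
      C₄ * Real.log x ^ k)
    (H4 : ∀ x : ℝ, 2 ≤ x → ∑ n ∈ Icc 1 ⌊x⌋₊, (σ 0 n : ℝ) ^ (12 * (A + 1)) ≤ C₅ * x * Real.log x ^ k)
    (F : Finset (Ideal (𝓞 K))) {X η Q : ℝ} (hX : 2 ≤ X) (hη0 : 0 ≤ η) (hη1 : η ≤ 1) (hQ : 1 ≤ Q)
    {Δ₀ D' : ℕ} (hΔ₀ : 0 < Δ₀) (hD'2 : 2 ≤ D') (hD'X : (D' : ℝ) ≤ 2 * X) {Δ : ℝ} (hΔpos : 0 < Δ)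
    (hΔ₀Δ : Δ ≤ 2 * Δ₀) (hX2Δ : X ^ 2 / Δ ≤ X ^ (3 / 2 : ℝ) + X * Real.sqrt Q) :
    ∑ d ∈ Ioc Δ₀ D', ∑ R ∈ F, (idealDivisorCount R : ℝ) ^ A *
        #{xy ∈ latticeBox (X / d) η | R ∣ Ideal.span {(d : 𝓞 K)} * pairIdeal xy} ≤
    C₂ * 5 ^ c₂ * 2 ^ (k : ℝ) * (8 * C₅ + 8 * C₄) *
      (Q + X * Real.sqrt Q + X ^ (3 / 2 : ℝ)) * Real.log (Q * X) ^ (c₂ + k) := by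
  set B : ℕ := 12 * (A + 1) with hB
  set L : ℝ := Real.log (Q * X) with hL
  have hX0 : 0 < X := by linarith
  have hQ0 : 0 < Q := by linarith
  obtain ⟨hl2L, -, -, -, hl2XL, -, hl8L⟩ := log_bounds hX hQ
  have hl2 : 0 < Real.log 2 := Real.log_pos one_lt_two
  have hL0 : 0 < L := hl2.trans_le hl2L
  have hΔ₀r : (0 : ℝ) < Δ₀ := by exact_mod_cast hΔ₀
  have hD'r : (2 : ℝ) ≤ D' := by exact_mod_cast hD'2
  -- each `d`
  have hterm : ∀ d ∈ Ioc Δ₀ D', ∑ R ∈ F, (idealDivisorCount R : ℝ) ^ A *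
        #{xy ∈ latticeBox (X / d) η | R ∣ Ideal.span {(d : 𝓞 K)} * pairIdeal xy} ≤
      C₂ * (5 * L) ^ c₂ * (4 * (σ 0 d : ℝ) ^ B + 4 * X ^ 2 * ((σ 0 d : ℝ) ^ B / (d : ℝ) ^ 2)) := by
    intro d hd
    rw [mem_Ioc] at hd
    have hd0 : 0 < d := lt_of_le_of_lt (Nat.zero_le _) hd.1
    have hdr : (1 : ℝ) ≤ d := by exact_mod_cast hd0
    refine (tail56_term_le h47 F hX0.le hd0).trans ?_
    set s : ℝ := max 2 (X * (1 + η) / d) with hs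
    -- `s² ≤ 4 + 4X²/d² ≤ 8X²`
    have ht0 : 0 ≤ X * (1 + η) / d := by positivity
    have ht : X * (1 + η) / d ≤ 2 * X / d := by
      refine div_le_div_of_nonneg_right ?_ (by positivity); nlinarith
    have hss : s * s ≤ 4 + 4 * X ^ 2 / (d : ℝ) ^ 2 := by
      rcases le_total 2 (X * (1 + η) / d) with h | h
      · rw [hs, max_eq_right h]
        have h2 : (X * (1 + η) / d) * (X * (1 + η) / d) ≤ (2 * X / d) * (2 * X / d) :=
          mul_le_mul ht ht ht0 (by positivity)
        calc (X * (1 + η) / d) * (X * (1 + η) / d) ≤ (2 * X / d) * (2 * X / d) := h2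
          _ = 4 * X ^ 2 / (d : ℝ) ^ 2 := by ring
          _ ≤ 4 + 4 * X ^ 2 / (d : ℝ) ^ 2 := by linarith
      · rw [hs, max_eq_left h]
        have : 0 ≤ 4 * X ^ 2 / (d : ℝ) ^ 2 := by positivity
        linarith
    have hs4 : 4 ≤ s * s := by nlinarith [le_max_left 2 (X * (1 + η) / d)]
    have hss8 : s * s ≤ 8 * X ^ 2 := by
      have h1 : 4 * X ^ 2 / (d : ℝ) ^ 2 ≤ 4 * X ^ 2 := div_le_self (by positivity) (by nlinarith)
      nlinarith
    have hlog0 : 0 ≤ Real.log (s * s) := Real.log_nonneg (by linarith)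
    have hlog : Real.log (s * s) ^ c₂ ≤ (5 * L) ^ c₂ :=
      Real.rpow_le_rpow hlog0 ((Real.log_le_log (by linarith) hss8).trans hl8L) hc₂
    have hσ0 : 0 ≤ (σ 0 d : ℝ) ^ B := by positivity
    calc (σ 0 d : ℝ) ^ (12 * (A + 1)) * (C₂ * s * s * Real.log (s * s) ^ c₂)
        = (σ 0 d : ℝ) ^ B * (C₂ * (s * s) * Real.log (s * s) ^ c₂) := by rw [hB]; ring
      _ ≤ (σ 0 d : ℝ) ^ B * (C₂ * (4 + 4 * X ^ 2 / (d : ℝ) ^ 2) * (5 * L) ^ c₂) := by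
          refine mul_le_mul_of_nonneg_left ?_ hσ0
          exact mul_le_mul (mul_le_mul_of_nonneg_left hss hC₂) hlog (Real.rpow_nonneg hlog0 _) (by positivity)
      _ = C₂ * (5 * L) ^ c₂ * (4 * (σ 0 d : ℝ) ^ B + 4 * X ^ 2 * ((σ 0 d : ℝ) ^ B / (d : ℝ) ^ 2)) := by
          ring
  refine (sum_le_sum hterm).trans ?_
  rw [← mul_sum, sum_add_distrib, ← mul_sum, ← mul_sum]
  -- the two rational sums
  have hsub : Ioc Δ₀ D' ⊆ Icc 1 ⌊(D' : ℝ)⌋₊ := by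
    intro d hd
    rw [mem_Ioc] at hd
    rw [Nat.floor_natCast, mem_Icc]
    omega
  have hmom : ∑ d ∈ Ioc Δ₀ D', (σ 0 d : ℝ) ^ B ≤ C₅ * D' * Real.log D' ^ k :=
    (sum_le_sum_of_subset_of_nonneg hsub fun d _ _ => by positivity).trans (H4 D' hD'r)
  have hdiv : ∑ d ∈ Ioc Δ₀ D', (σ 0 d : ℝ) ^ B / (d : ℝ) ^ 2 ≤ (Δ₀ : ℝ)⁻¹ * (C₄ * Real.log D' ^ k) := by
    have h1 : ∀ d ∈ Ioc Δ₀ D', (σ 0 d : ℝ) ^ B / (d : ℝ) ^ 2 ≤ (Δ₀ : ℝ)⁻¹ * ((σ 0 d : ℝ) ^ B / d) := by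
      intro d hd
      rw [mem_Ioc] at hd
      have hdr : (Δ₀ : ℝ) < d := by exact_mod_cast hd.1
      have hd0 : (0 : ℝ) < d := hΔ₀r.trans hdr
      rw [sq, div_mul_eq_div_div, ← one_div, mul_comm, ← div_eq_mul_one_div]
      exact div_le_div_of_nonneg_left (by positivity) hΔ₀r hdr.le
    refine (sum_le_sum h1).trans ?_
    rw [← mul_sum]
    exact mul_le_mul_of_nonneg_left
      ((sum_le_sum_of_subset_of_nonneg hsub fun d _ _ => by positivity).trans (H4div D' hD'r))
      (by positivity)
  -- logarithms, `D'`, `Δ`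
  have hlogD0 : 0 ≤ Real.log D' := Real.log_nonneg (by linarith)
  have hlogD : Real.log D' ^ k ≤ (2 * L) ^ k :=
    pow_le_pow_left₀ hlogD0 ((Real.log_le_log (by linarith) hD'X).trans hl2XL) k
  have hinvΔ : (Δ₀ : ℝ)⁻¹ ≤ 2 / Δ := by
    rw [inv_eq_one_div, div_le_div_iff₀ hΔ₀r hΔpos]; linarith
  set P : ℝ := Q + X * Real.sqrt Q + X ^ (3 / 2 : ℝ) with hP
  have hX32 : X ≤ X ^ (3 / 2 : ℝ) := by
    calc X = X ^ (1 : ℝ) := (Real.rpow_one X).symm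
      _ ≤ X ^ (3 / 2 : ℝ) := Real.rpow_le_rpow_of_exponent_le (by linarith) (by norm_num)
  have hsq0 : 0 ≤ X * Real.sqrt Q := by positivity
  have hXP : X ≤ P := by rw [hP]; linarith
  have hQP : X ^ (3 / 2 : ℝ) + X * Real.sqrt Q ≤ P := by rw [hP]; linarith
  have hP0 : 0 ≤ P := by linarith
  have h2k : (2 * L) ^ k = 2 ^ (k : ℝ) * L ^ (k : ℝ) := by
    rw [mul_pow, ← Real.rpow_natCast, ← Real.rpow_natCast]
  have h5c : (5 * L) ^ c₂ = 5 ^ c₂ * L ^ c₂ := Real.mul_rpow (by norm_num) hL0.le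
  have hLck : L ^ c₂ * L ^ (k : ℝ) = L ^ (c₂ + k) := by rw [← Real.rpow_add hL0]
  have hA1 : 4 * ∑ d ∈ Ioc Δ₀ D', (σ 0 d : ℝ) ^ B ≤ 8 * C₅ * X * (2 * L) ^ k := by
    calc 4 * ∑ d ∈ Ioc Δ₀ D', (σ 0 d : ℝ) ^ B ≤ 4 * (C₅ * D' * Real.log D' ^ k) :=
          mul_le_mul_of_nonneg_left hmom (by norm_num)
      _ ≤ 4 * (C₅ * (2 * X) * (2 * L) ^ k) := by gcongr
      _ = 8 * C₅ * X * (2 * L) ^ k := by ring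
  have hA2 : 4 * X ^ 2 * ∑ d ∈ Ioc Δ₀ D', (σ 0 d : ℝ) ^ B / (d : ℝ) ^ 2 ≤
      8 * C₄ * (X ^ (3 / 2 : ℝ) + X * Real.sqrt Q) * (2 * L) ^ k := by
    calc 4 * X ^ 2 * ∑ d ∈ Ioc Δ₀ D', (σ 0 d : ℝ) ^ B / (d : ℝ) ^ 2
        ≤ 4 * X ^ 2 * ((Δ₀ : ℝ)⁻¹ * (C₄ * Real.log D' ^ k)) := mul_le_mul_of_nonneg_left hdiv (by positivity)
      _ ≤ 4 * X ^ 2 * ((2 / Δ) * (C₄ * (2 * L) ^ k)) := by gcongr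
      _ = 8 * C₄ * (X ^ 2 / Δ) * (2 * L) ^ k := by ring
      _ ≤ 8 * C₄ * (X ^ (3 / 2 : ℝ) + X * Real.sqrt Q) * (2 * L) ^ k := by gcongr
  calc C₂ * (5 * L) ^ c₂ * (4 * ∑ d ∈ Ioc Δ₀ D', (σ 0 d : ℝ) ^ B +
          4 * X ^ 2 * ∑ d ∈ Ioc Δ₀ D', (σ 0 d : ℝ) ^ B / (d : ℝ) ^ 2)
      ≤ C₂ * (5 * L) ^ c₂ * (8 * C₅ * X * (2 * L) ^ k +
          8 * C₄ * (X ^ (3 / 2 : ℝ) + X * Real.sqrt Q) * (2 * L) ^ k) :=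
        mul_le_mul_of_nonneg_left (add_le_add hA1 hA2) (by positivity)
    _ = C₂ * (5 * L) ^ c₂ * (2 * L) ^ k * (8 * C₅ * X + 8 * C₄ * (X ^ (3 / 2 : ℝ) + X * Real.sqrt Q)) := by
        ring
    _ ≤ C₂ * (5 * L) ^ c₂ * (2 * L) ^ k * (8 * C₅ * P + 8 * C₄ * P) := by
        refine mul_le_mul_of_nonneg_left (add_le_add ?_ ?_) (by positivity)
        · exact mul_le_mul_of_nonneg_left hXP (by positivity)
        · exact mul_le_mul_of_nonneg_left hQP (by positivity)
    _ = C₂ * 5 ^ c₂ * 2 ^ (k : ℝ) * (8 * C₅ + 8 * C₄) * P * L ^ (c₂ + k) := by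
        rw [h5c, h2k, ← hLck]; ring

/-! ### Lemma 3.2 from Lemma 4.7 and Lemma 5.1 -/

open scoped Classical in
/-- **Heath-Brown's Lemma 3.2 deduced from Lemmas 4.7 and 5.1** (pp. 30–32). Granted
(i) the estimate of **Lemma 4.7** — for every `A ≥ 1` there are `c, C ≥ 0` with
`∑_{|m|≤x,|n|≤y,mn≠0} τ((m + n·2^{1/3}))^A ≤ C xy (log xy)^c` for `x, y ≥ 2` — and
(ii) the estimate of **Lemma 5.1** — for every `A ≥ 1` there are `c, C ≥ 0` with
`∑_{Q<N(R)≤2Q, R∈𝒯r} τ(R)^A |S(R; X) − η²X²/N(R)| ≤ C (X + Q) log(Q+2)^c` for `X ≥ 1`, `0 < η ≤ 1`, `Q > 0` —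
the named fact `HeathBrown2001_typeI_A` (**Lemma 3.2**, the Type I bound for `𝒜^(K)` with level of
distribution `X^{2−ε}`) holds. Proof as printed: Möbius inversion (5.3) and the singular series
(5.4) (`abs_countA_sub_mainTerm_le`), the head `d ≤ Δ` via Lemma 5.1 (`head_total_le`), the tails
(5.5) (`exists_tail55_le`) and (5.6) via Lemma 4.7 (`tail56_total_le`), Lemma 4.2 (the tree's
moments of `τ`) and the choice `Δ = 1 + min(X^{1/2}, XQ^{-1/2})` (`delta_bounds`), giving
`≪ (Q + XQ^{1/2} + X^{3/2})(log QX)^{c(A)}`. [cite: HeathBrownActa2001, Lemma 3.2] -/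
theorem HeathBrown2001_typeI_A_of_bounds
    (h47 : ∀ A : ℕ, 0 < A → ∃ c C : ℝ, 0 ≤ c ∧ 0 ≤ C ∧ ∀ x y : ℝ, 2 ≤ x → 2 ≤ y →
      ∑ m ∈ (Icc (-⌊x⌋) ⌊x⌋).filter (· ≠ 0), ∑ n ∈ (Icc (-⌊y⌋) ⌊y⌋).filter (· ≠ 0),
        (idealDivisorCount (Ideal.span {((m : ℤ) : 𝓞 K) + ((n : ℤ) : 𝓞 K) * θint}) : ℝ) ^ A ≤
      C * x * y * Real.log (x * y) ^ c)
    (h51 : ∀ A : ℕ, 0 < A → ∃ c C : ℝ, 0 ≤ c ∧ 0 ≤ C ∧ ∀ X η Q : ℝ, 1 ≤ X → 0 < η → η ≤ 1 → 0 < Q →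
      ∑ R ∈ (idealsLE ⌊2 * Q⌋₊).filter (fun R => Q < (Ideal.absNorm R : ℝ) ∧
          (Ideal.absNorm R : ℝ) ≤ 2 * Q ∧ Squarefree (Ideal.absNorm R)),
        (idealDivisorCount R : ℝ) ^ A * |(latticeCount X η R : ℝ) - η ^ 2 * X ^ 2 / Ideal.absNorm R| ≤
      C * (X + Q) * Real.log (Q + 2) ^ c) :
    HeathBrown2001_typeI_A := by
  intro A hA
  obtain ⟨c₁, C₁, hc₁, hC₁, H51⟩ := h51 A hA
  obtain ⟨c₂, C₂, hc₂, hC₂, H47⟩ := h47 (A + 1) (Nat.succ_pos A)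
  obtain ⟨C₃, hC₃, H55⟩ := exists_tail55_le A
  obtain ⟨C₄, hC₄, H4div⟩ := exists_sum_sigma_zero_pow_div_le_real (12 * (A + 1))
  obtain ⟨C₅, hC₅, H4⟩ := exists_sum_sigma_zero_pow_le_real (12 * (A + 1))
  -- exponents and constants (depending on `A` only)
  obtain ⟨k, hk⟩ : ∃ k : ℕ, k = 2 ^ (12 * (A + 1) + 1) := ⟨_, rfl⟩
  obtain ⟨k₃, hk₃⟩ : ∃ k₃ : ℕ, k₃ = 2 ^ (4 * A + 5) := ⟨_, rfl⟩
  rw [← hk] at H4div H4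
  rw [← hk₃] at H55
  set e₁ : ℝ := c₁ + k with he₁
  set e₂ : ℝ := c₂ + k with he₂
  set e₃ : ℝ := (k₃ : ℝ) with he₃
  set cfin : ℝ := e₁ + e₂ + e₃ with hcfin
  set M : ℝ := (Real.log 2)⁻¹ ^ cfin with hM
  set K₁ : ℝ := C₁ * 2 ^ c₁ * 3 ^ (k : ℝ) * (C₄ + 2 * C₅) with hK₁
  set K₂ : ℝ := C₂ * 5 ^ c₂ * 2 ^ (k : ℝ) * (8 * C₅ + 8 * C₄) with hK₂
  set K₃ : ℝ := 2 * C₃ with hK₃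
  have he₁0 : 0 ≤ e₁ := by positivity
  have he₂0 : 0 ≤ e₂ := by positivity
  have he₃0 : 0 ≤ e₃ := by positivity
  have he₁c : e₁ ≤ cfin := by rw [hcfin]; linarith only [he₂0, he₃0]
  have he₂c : e₂ ≤ cfin := by rw [hcfin]; linarith only [he₁0, he₃0]
  have he₃c : e₃ ≤ cfin := by rw [hcfin]; linarith only [he₁0, he₂0]
  have hK₁0 : 0 ≤ K₁ := by positivity
  have hK₂0 : 0 ≤ K₂ := by positivity
  have hK₃0 : 0 ≤ K₃ := by positivity
  have hM0 : 0 ≤ M := by positivity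
  refine ⟨cfin, (K₁ + K₂ + K₃) * M, fun X η Q hX hηlo hη1 hQ => ?_⟩
  -- the data
  have hX0 : 0 < X := by linarith only [hX]
  have hQ0 : 0 < Q := by linarith only [hQ]
  have hη0 : 0 < η := (Real.exp_pos _).trans_le hηlo
  obtain ⟨hl2L, -, -, -, -, hlsqL, -⟩ := log_bounds hX hQ
  set L : ℝ := Real.log (Q * X) with hL
  have hl2 : 0 < Real.log 2 := Real.log_pos one_lt_two
  have hL0 : 0 < L := hl2.trans_le hl2L
  obtain ⟨hΔ₀1, hΔ₀Δ, hΔ2Δ₀, hΔ₀X, hΔsq, hX2Δ, hQΔ⟩ := delta_bounds hX hQ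
  set Δ : ℝ := 1 + min (Real.sqrt X) (X / Real.sqrt Q) with hΔdef
  set Δ₀ : ℕ := ⌊Δ⌋₊ with hΔ₀def
  have hΔ₀pos : 0 < Δ₀ := hΔ₀1
  have hΔ₀r : (1 : ℝ) ≤ Δ₀ := by exact_mod_cast hΔ₀1
  have hΔpos : 0 < Δ := by linarith only [hΔ₀r, hΔ₀Δ]
  obtain ⟨D, hDdef⟩ : ∃ D : ℕ, D = ⌊X * (1 + η)⌋₊ := ⟨_, rfl⟩
  obtain ⟨D', hD'def⟩ : ∃ D' : ℕ, D' = max D Δ₀ := ⟨_, rfl⟩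
  have hDD' : D ≤ D' := by rw [hD'def]; exact le_max_left _ _
  have hΔ₀D' : Δ₀ ≤ D' := by rw [hD'def]; exact le_max_right _ _
  have hXη2 : (2 : ℝ) ≤ X * (1 + η) := by nlinarith only [hX, hη0]
  have hD2 : 2 ≤ D := by rw [hDdef]; exact Nat.le_floor (by exact_mod_cast hXη2)
  have hD'2 : 2 ≤ D' := hD2.trans hDD'
  have hDfl : ⌊X * (1 + η)⌋₊ ≤ D' := by rw [← hDdef]; exact hDD'
  have hD'X : (D' : ℝ) ≤ 2 * X := by
    rw [hD'def, Nat.cast_max]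
    refine max_le ?_ ?_
    · have h1 : (D : ℝ) ≤ X * (1 + η) := by rw [hDdef]; exact Nat.floor_le (by positivity)
      have h2 : X * (1 + η) ≤ 2 * X := by nlinarith only [hX0, hη1]
      exact h1.trans h2
    · have hsqrt : Real.sqrt X ≤ X := by
        rw [Real.sqrt_le_left hX0.le]; nlinarith only [hX]
      linarith only [hΔ₀Δ, hΔsq, hsqrt, hX]
  have hx₁ : Real.log (max 2 (Δ₀ : ℝ)) ≤ 3 * L := by
    have h1 : max 2 (Δ₀ : ℝ) ≤ 2 + 2 * Real.sqrt X := by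
      refine max_le ?_ ?_
      · linarith only [Real.sqrt_nonneg X]
      · linarith only [hΔ₀Δ, hΔsq, Real.sqrt_nonneg X]
    exact (Real.log_le_log (by positivity) h1).trans hlsqL
  have hQΔ₀ : Q * Δ₀ ≤ Q + X * Real.sqrt Q := (mul_le_mul_of_nonneg_left hΔ₀Δ hQ0.le).trans hQΔ
  set tr := (idealsLE ⌊2 * Q⌋₊).filter (fun R => Q < (Ideal.absNorm R : ℝ) ∧
    (Ideal.absNorm R : ℝ) ≤ 2 * Q ∧ Squarefree (Ideal.absNorm R)) with htr
  set P : ℝ := Q + X * Real.sqrt Q + X ^ (3 / 2 : ℝ) with hP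
  have hP0 : 0 ≤ P := by positivity
  have hQP : X ^ (3 / 2 : ℝ) + X * Real.sqrt Q ≤ P := by rw [hP]; linarith only [hQ0]
  -- the summands
  set Lf : Ideal (𝓞 K) → ℕ → ℝ := fun R d =>
    (#{xy ∈ latticeBox (X / d) η | R ∣ Ideal.span {(d : 𝓞 K)} * pairIdeal xy} : ℝ) with hLf
  set Mf : Ideal (𝓞 K) → ℕ → ℝ := fun R d =>
    η ^ 2 * X ^ 2 * Ideal.absNorm (R ⊔ Ideal.span {(d : 𝓞 K)}) / ((d : ℝ) ^ 2 * Ideal.absNorm R) with hMf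
  set Uf : Ideal (𝓞 K) → ℝ := fun R =>
    η ^ 2 * X ^ 2 / Ideal.absNorm R * (4 * σ 0 (Ideal.absNorm R) / Δ₀) with hUf
  -- Step 1: the split, pointwise in `R`
  have hstep1 : ∀ R ∈ tr, (idealDivisorCount R : ℝ) ^ A *
      |(countA X η R : ℝ) - 6 * η ^ 2 * X ^ 2 / Real.pi ^ 2 * rho₂ R / Ideal.absNorm R| ≤
      (idealDivisorCount R : ℝ) ^ A *
        (∑ d ∈ Icc 1 Δ₀, |Lf R d - Mf R d| + ∑ d ∈ Ioc Δ₀ D', Lf R d + Uf R) := by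
    intro R hR
    rw [htr, mem_filter] at hR
    obtain ⟨-, -, -, hsq⟩ := hR
    exact mul_le_mul_of_nonneg_left
      (abs_countA_sub_mainTerm_le hX0.le hsq hΔ₀pos hΔ₀D' hDfl) (by positivity)
  -- Step 2: summation over `R` and interchange
  have hstep2 : ∑ R ∈ tr, (idealDivisorCount R : ℝ) ^ A *
        (∑ d ∈ Icc 1 Δ₀, |Lf R d - Mf R d| + ∑ d ∈ Ioc Δ₀ D', Lf R d + Uf R) =
      ∑ d ∈ Icc 1 Δ₀, ∑ R ∈ tr, (idealDivisorCount R : ℝ) ^ A * |Lf R d - Mf R d| +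
        ∑ d ∈ Ioc Δ₀ D', ∑ R ∈ tr, (idealDivisorCount R : ℝ) ^ A * Lf R d +
          ∑ R ∈ tr, (idealDivisorCount R : ℝ) ^ A * Uf R := by
    simp only [mul_add, sum_add_distrib, mul_sum]
    congr 1
    congr 1
    · exact sum_comm
    · exact sum_comm
  -- Step 3: the three pieces
  have hhead : ∑ d ∈ Icc 1 Δ₀, ∑ R ∈ tr, (idealDivisorCount R : ℝ) ^ A * |Lf R d - Mf R d| ≤
      K₁ * P * L ^ e₁ :=
    head_total_le hc₁ hC₁ hC₄.le hC₅.le H51 H4div H4 hX hη0 hη1 hQ hΔ₀pos hΔ₀X hx₁ hQΔ₀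
  have htail56 : ∑ d ∈ Ioc Δ₀ D', ∑ R ∈ tr, (idealDivisorCount R : ℝ) ^ A * Lf R d ≤ K₂ * P * L ^ e₂ :=
    tail56_total_le hc₂ hC₂ hC₄.le hC₅.le H47 H4div H4 tr hX hη0.le hη1 hQ hΔ₀pos hD'2 hD'X hΔpos
      hΔ2Δ₀ hX2Δ
  have htail55 : ∑ R ∈ tr, (idealDivisorCount R : ℝ) ^ A * Uf R ≤ K₃ * P * L ^ e₃ := by
    obtain ⟨-, -, hl2QL, -, -, -, -⟩ := log_bounds hX hQ
    have h := H55 X η Q hη0.le hη1 hQ Δ₀ hΔ₀pos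
    have hlog2Q0 : 0 ≤ Real.log (2 * Q) := Real.log_nonneg (by linarith only [hQ])
    have hlog : Real.log (2 * Q) ^ k₃ ≤ L ^ k₃ := pow_le_pow_left₀ hlog2Q0 hl2QL k₃
    have hinvΔ : (Δ₀ : ℝ)⁻¹ ≤ 2 / Δ := by
      rw [inv_eq_one_div, div_le_div_iff₀ (by linarith only [hΔ₀r]) hΔpos]; linarith only [hΔ2Δ₀]
    calc ∑ R ∈ tr, (idealDivisorCount R : ℝ) ^ A * Uf R
        ≤ C₃ * X ^ 2 * Real.log (2 * Q) ^ k₃ / Δ₀ := h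
      _ = C₃ * Real.log (2 * Q) ^ k₃ * X ^ 2 * (Δ₀ : ℝ)⁻¹ := by ring
      _ ≤ C₃ * L ^ k₃ * X ^ 2 * (2 / Δ) := by gcongr
      _ = 2 * C₃ * (X ^ 2 / Δ) * L ^ k₃ := by ring
      _ ≤ 2 * C₃ * P * L ^ k₃ := by
          refine mul_le_mul_of_nonneg_right (mul_le_mul_of_nonneg_left (hX2Δ.trans hQP) (by positivity)) ?_
          positivity
      _ = K₃ * P * L ^ e₃ := by rw [hK₃, he₃, Real.rpow_natCast]
  -- Step 4: the exponents
  have hpow : ∀ {e : ℝ}, 0 ≤ e → e ≤ cfin → L ^ e ≤ M * L ^ cfin := fun he hec =>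
    rpow_le_inv_log_two_pow_mul hl2L he hec
  calc ∑ R ∈ tr, (idealDivisorCount R : ℝ) ^ A *
          |(countA X η R : ℝ) - 6 * η ^ 2 * X ^ 2 / Real.pi ^ 2 * rho₂ R / Ideal.absNorm R|
      ≤ ∑ R ∈ tr, (idealDivisorCount R : ℝ) ^ A *
          (∑ d ∈ Icc 1 Δ₀, |Lf R d - Mf R d| + ∑ d ∈ Ioc Δ₀ D', Lf R d + Uf R) := sum_le_sum hstep1
    _ = _ := hstep2
    _ ≤ K₁ * P * L ^ e₁ + K₂ * P * L ^ e₂ + K₃ * P * L ^ e₃ := add_le_add (add_le_add hhead htail56) htail55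
    _ ≤ K₁ * P * (M * L ^ cfin) + K₂ * P * (M * L ^ cfin) + K₃ * P * (M * L ^ cfin) := by
        refine add_le_add (add_le_add ?_ ?_) ?_
        · exact mul_le_mul_of_nonneg_left (hpow he₁0 he₁c) (by positivity)
        · exact mul_le_mul_of_nonneg_left (hpow he₂0 he₂c) (by positivity)
        · exact mul_le_mul_of_nonneg_left (hpow he₃0 he₃c) (by positivity)
    _ = (K₁ + K₂ + K₃) * M * (Q + X * Real.sqrt Q + X ^ (3 / 2 : ℝ)) * Real.log (Q * X) ^ cfin := by
        rw [hP, hL]; ring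

end Literature.NumberTheory.Sieve.CubicSieve

end
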